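/-
Copyright: cell gate-hubbard-kl, typer seat t6 (D-0069 (2) B1 statement-typer wave). Proof file: discharges the named
fact `Lemma12TreeLineDecay` of `FermiRG/DR2000PartI.lean`; nothing here is a claim about the Hubbard model or about
superconductivity.
-/
import Mathlib
import Literature.MathematicalPhysics.QuantumLattice.FermiRG.DR2000PartI
import Literature.MathematicalPhysics.QuantumLattice.SectorSymbolMasterSmooth
import Literature.Analysis.Fourier.FourierDecayFromDerivBounds
import Literature.Analysis.Fourier.FourierLinearChange
import Literature.Analysis.Calculus.LineRestrictionIteratedDeriv
import Literature.Analysis.SpecialFunctions.ArgAffineLineDerivatives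
import HarnessLib

/-!
# Disertori–Rivasseau 2000, Part I, Appendix A, Lemma 12 — PROVED: Gevrey (stretched-exponential) decay of the
sectorised tree-line propagator `C₀^{w_q}`

M. Disertori, V. Rivasseau, *Interacting Fermi liquid in two dimensions at finite temperature. Part I: Convergent
Attributions*, Commun. Math. Phys. **215** (2000) 251–290, arXiv:cond-mat/9907130 [DisertoriRivasseau2000], App. A
Lemma 12 «C₀^{w_q} satisfies (IV.21)», render `paper:arxiv-cond-mat_9907130` p0016:L134–170, p0017:L1–26 (LOCATOR =
chunk:line of the corpus-TeX render), with (IV.21) = (A.1) p0016:L88–97: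
`|C₀^{w_q}(δx, θ)| ≤ K (Λ₀²−Λ²)/Λ⁴(w_q) · Λ^{1/2}(w_q)Λ³(w_q) · e^{−a[|δx₀Λ(w_q)|^{1/s} + |δx_rΛ(w_q)|^{1/s} + |δx_tΛ^{1/2}(w_q)|^{1/s}]}`.
This file discharges the named fact `Literature.MathematicalPhysics.QuantumLattice.FermiRG.DR2000.Lemma12TreeLineDecay`
(cell FACT-LIST F-052, DAG row DR1.L12) of the DEFINITION-FROZEN statement file `FermiRG/DR2000PartI.lean` WITHOUT
touching that file: `theorem Lemma12TreeLineDecay_holds : Lemma12TreeLineDecay`.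

THE PRINTED PROOF (p0016:L136–p0017:L26) and this file.  Print: in the radial/tangential momentum coordinates of the
sector, `C^{w_q,θ}(k₀,k_r,k_t) = F₁ F₂ F₃` with `F₁ = u_p[α_q^{1/4} f₁(k_r,k_t)]` (`f₁ = θ − θ_s`, the relative angle),
`F₂ = ik₀ + f₂` (`f₂ = e(k⃗)`), `F₃ = u'[α_q(k₀² + f₂²)]`; «By hand or using the standard rules for derivation, product
and composition of Gevrey functions (see [G]) it is then easy to check that C₀^{w_q,θ} is a Gevrey function with
compact support of class s» with `‖∂₀^{n₀}∂_r^{n_r}∂_t^{n_t} C‖_∞ ≤ α_q^{-1/2} C₀^{|n|} α_q^{(n_r+n₀)/2} α_q^{n_t/4}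
(n₀!n_r!n_t!)^s`; «Hence, applying Lemma [11] … proves (IV.21)».  We follow exactly this, supplying the «standard
rules» as proved lemmas:
* §1 the ONE-VARIABLE GEVREY TOOLKIT at a point: bounds `‖f^{(n)}(x)‖ ≤ A Cⁿ (n!)^s` are stable under sums, products
  (Leibniz) and — the rule Mathlib's `norm_iteratedFDeriv_comp_le` loses a factor `n!` on — COMPOSITION, via Mathlib's
  one-variable Faà di Bruno formula over ordered finpartitions (`iteratedDeriv_scomp_eq_sum_orderedFinpartition`) and
  the combinatorial estimate `Σ_{c ∈ OFP(n)} x^{|c|} (|c|! ∏_i |c_i|!)^s ≤ (x+2)ⁿ (n!)^s` (`s ≥ 1`), proved by induction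
  over `OrderedFinpartition.extendEquiv`;
* §2 sup-norm Gevrey bounds of `u` and `u'` from the `L¹` Gevrey class (II.14) of the statement file (`(n/e)ⁿ ≤ n!`);
* §3 the sector chart of the Lemma 5 proof file (`FermiRG/DR2000RootKernelDecayProof.lean`): with `σ = Λ(w_q)^{1/2}`
  and `k = (σ²t₀, (1 + σ²t₁)e(θ) + σ t₂ τ(θ))`, `C^{w_q}(k)χ_θ(θ(k⃗)) = (1 − Λ²)σ^{-6} · N_σ(t)` with the θ-FREE normalized
  symbol `N_σ(t) = u'(t₀² + Ẽ²)(it₀ + Ẽ)u(arg U/σ)`, `Ẽ = 2t₁ + σ²t₁² + t₂²` (so `f₂ = σ²Ẽ`: the curvature of the Fermi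
  circle), `U = (1 + σ²t₁) + iσt₂` (so `f₁ = arg U`); its support lies in a fixed box on which `Re U ≥ 2/5`;
* §4 along every coordinate line of the chart `N_σ` has Gevrey-`s` bounds UNIFORM in `σ ∈ (0,1]` (this is the printed
  anisotropic estimate: one `∂_t` costs `‖∂U‖ ≤ 2σ` against the `1/σ` of the sector cutoff — tree file
  `Analysis/SpecialFunctions/ArgAffineLineDerivatives`);
* §5 integration by parts in each direction to all orders (tree `Analysis/Fourier/DirectionalFourierDecay`), the
  optimisation of the order (Lemma 11's step, `n = ⌊(y/C)^{1/s}/2⌋`), and the geometric mean of the three directional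
  decays; §6 the change of variables back to `δx` (Jacobian `σ⁵`, dual scales; tree `Analysis/Fourier/FourierLinearChange`).
No definitions; all helpers are `private`.
-/

noncomputable section

open scoped Nat BigOperators ContDiff Topology FourierTransform InnerProductSpace
open Set Filter Complex Function MeasureTheory

namespace Literature.MathematicalPhysics.QuantumLattice.FermiRG.DR2000

open Literature.MathematicalPhysics.QuantumLattice Literature.Analysis.Calculus Literature.Analysis.Fourier
  Literature.Analysis.SpecialFunctions

/-! ## 1. The one-variable Gevrey toolkit

### 1a. Combinatorics of ordered finpartitions: `Σ_{c ∈ OFP(n)} x^{|c|} (|c|! ∏_i |c_i|!)^s ≤ (x+2)ⁿ (n!)^s` -/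

/-- `P(c) = |c|! ∏ |c_i|!` under the extension by a new singleton block: `P = (|c|+1) P(c)`. [folklore] -/
private theorem weight_extend_none {n : ℕ} (c : OrderedFinpartition n) :
    (((c.extend none).length ! : ℕ) : ℝ) * ∏ i, ((((c.extend none).partSize i)! : ℕ) : ℝ) =
      ((c.length : ℝ) + 1) * (((c.length ! : ℕ) : ℝ) * ∏ i, (((c.partSize i)! : ℕ) : ℝ)) := by
  change (((c.length + 1) ! : ℕ) : ℝ) * ∏ i : Fin (c.length + 1), ((((Fin.cons 1 c.partSize : Fin (c.length + 1) → ℕ) i)! : ℕ) : ℝ) = _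
  rw [Fin.prod_univ_succ, Nat.factorial_succ]
  simp only [Fin.cons_zero, Fin.cons_succ, Nat.factorial_one, Nat.cast_one, one_mul]
  push_cast
  ring

/-- The new singleton raises the number of blocks by one. [folklore] -/
private theorem length_extend_none {n : ℕ} (c : OrderedFinpartition n) : (c.extend none).length = c.length + 1 := rfl

/-- `P(c)` under the extension of the `k`-th block: `P = (|c_k|+1) P(c)`. [folklore] -/
private theorem weight_extend_some {n : ℕ} (c : OrderedFinpartition n) (k : Fin c.length) :
    (((c.extend (some k)).length ! : ℕ) : ℝ) * ∏ i, ((((c.extend (some k)).partSize i)! : ℕ) : ℝ) =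
      ((c.partSize k : ℝ) + 1) * (((c.length ! : ℕ) : ℝ) * ∏ i, (((c.partSize i)! : ℕ) : ℝ)) := by
  change ((c.length ! : ℕ) : ℝ) * ∏ i : Fin c.length, (((Function.update c.partSize k (c.partSize k + 1) i)! : ℕ) : ℝ) = _
  rw [← Finset.mul_prod_erase Finset.univ _ (Finset.mem_univ k),
    ← Finset.mul_prod_erase Finset.univ (fun i => (((c.partSize i)! : ℕ) : ℝ)) (Finset.mem_univ k)]
  rw [Finset.prod_congr rfl (fun i hi => by rw [Function.update_of_ne (Finset.ne_of_mem_erase hi)]),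
    Function.update_self, Nat.factorial_succ]
  push_cast
  ring

/-- Extending a block keeps the number of blocks. [folklore] -/
private theorem length_extend_some {n : ℕ} (c : OrderedFinpartition n) (k : Fin c.length) :
    (c.extend (some k)).length = c.length := rfl

/-- `Σ_i |c_i| = n`. [folklore] -/
private theorem sum_partSize {n : ℕ} (c : OrderedFinpartition n) : ∑ i, c.partSize i = n := by
  have h := c.sum_sigma_eq_sum (fun _ => (1 : ℕ))
  simpa using h

/-- The one-step bound: `Σ_o x^{|c.extend o|} P(c.extend o)^s ≤ (x+2)(n+1)^s x^{|c|} P(c)^s` (`s ≥ 1`, `x ≥ 0`):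
`(|c|+1)^s ≤ (n+1)^s` for the singleton, `Σ_k (|c_k|+1)^s ≤ (n+1)^{s-1}(n + |c|) ≤ 2(n+1)^s` for the blocks. [folklore] -/
private theorem sum_extend_weight_le {s x : ℝ} (hs : 1 ≤ s) (hx : 0 ≤ x) {n : ℕ} (c : OrderedFinpartition n) :
    ∑ o : Option (Fin c.length), x ^ (c.extend o).length *
        ((((c.extend o).length ! : ℕ) : ℝ) * ∏ i, ((((c.extend o).partSize i)! : ℕ) : ℝ)) ^ s ≤
      (x + 2) * ((n : ℝ) + 1) ^ s * (x ^ c.length * ((((c.length ! : ℕ) : ℝ) * ∏ i, (((c.partSize i)! : ℕ) : ℝ))) ^ s) := by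
  set P : ℝ := ((c.length ! : ℕ) : ℝ) * ∏ i, (((c.partSize i)! : ℕ) : ℝ) with hP
  have hP0 : 0 ≤ P := by positivity
  have hs0 : 0 ≤ s := by linarith
  have hlen : (c.length : ℝ) ≤ n := by exact_mod_cast c.length_le
  have hn1 : (1 : ℝ) ≤ (n : ℝ) + 1 := by linarith [(Nat.cast_nonneg n : (0 : ℝ) ≤ n)]
  rw [Fintype.sum_option, weight_extend_none, length_extend_none]
  simp_rw [weight_extend_some, length_extend_some]
  have h1 : x ^ (c.length + 1) * (((c.length : ℝ) + 1) * P) ^ s ≤ x * ((n : ℝ) + 1) ^ s * (x ^ c.length * P ^ s) := by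
    rw [pow_succ, Real.mul_rpow (by positivity) hP0]
    have : ((c.length : ℝ) + 1) ^ s ≤ ((n : ℝ) + 1) ^ s := Real.rpow_le_rpow (by positivity) (by linarith) hs0
    calc x ^ c.length * x * (((c.length : ℝ) + 1) ^ s * P ^ s)
        = x * ((c.length : ℝ) + 1) ^ s * (x ^ c.length * P ^ s) := by ring
      _ ≤ x * ((n : ℝ) + 1) ^ s * (x ^ c.length * P ^ s) := by gcongr
  have h2 : ∑ k : Fin c.length, x ^ c.length * (((c.partSize k : ℝ) + 1) * P) ^ s ≤
      2 * ((n : ℝ) + 1) ^ s * (x ^ c.length * P ^ s) := by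
    have hk : ∀ k : Fin c.length, x ^ c.length * (((c.partSize k : ℝ) + 1) * P) ^ s ≤
        ((n : ℝ) + 1) ^ (s - 1) * ((c.partSize k : ℝ) + 1) * (x ^ c.length * P ^ s) := by
      intro k
      have hmk : ((c.partSize k : ℝ) + 1) ≤ (n : ℝ) + 1 := by
        have := c.partSize_le k
        exact_mod_cast Nat.succ_le_succ this
      have hmk0 : (0 : ℝ) ≤ (c.partSize k : ℝ) + 1 := by positivity
      rw [Real.mul_rpow hmk0 hP0]
      have hsplit : ((c.partSize k : ℝ) + 1) ^ s = ((c.partSize k : ℝ) + 1) ^ (s - 1) * ((c.partSize k : ℝ) + 1) := by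
        conv_lhs => rw [show s = (s - 1) + 1 by ring, Real.rpow_add (by positivity) (s - 1) 1, Real.rpow_one]
      rw [hsplit]
      have : ((c.partSize k : ℝ) + 1) ^ (s - 1) ≤ ((n : ℝ) + 1) ^ (s - 1) :=
        Real.rpow_le_rpow hmk0 hmk (by linarith)
      calc x ^ c.length * (((c.partSize k : ℝ) + 1) ^ (s - 1) * ((c.partSize k : ℝ) + 1) * P ^ s)
          = ((c.partSize k : ℝ) + 1) ^ (s - 1) * ((c.partSize k : ℝ) + 1) * (x ^ c.length * P ^ s) := by ring
        _ ≤ ((n : ℝ) + 1) ^ (s - 1) * ((c.partSize k : ℝ) + 1) * (x ^ c.length * P ^ s) := by gcongr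
    refine (Finset.sum_le_sum fun k _ => hk k).trans ?_
    rw [← Finset.sum_mul, ← Finset.mul_sum, Finset.sum_add_distrib, Finset.sum_const, Finset.card_univ,
      Fintype.card_fin, nsmul_eq_mul, mul_one]
    have hsum : ∑ k : Fin c.length, (c.partSize k : ℝ) = n := by exact_mod_cast sum_partSize c
    rw [hsum]
    have hle : (n : ℝ) + c.length ≤ 2 * ((n : ℝ) + 1) := by linarith
    have hpow : ((n : ℝ) + 1) ^ (s - 1) * ((n : ℝ) + 1) = ((n : ℝ) + 1) ^ s := by
      conv_rhs => rw [show s = (s - 1) + 1 by ring, Real.rpow_add (by positivity) (s - 1) 1, Real.rpow_one]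
    calc ((n : ℝ) + 1) ^ (s - 1) * ((n : ℝ) + c.length) * (x ^ c.length * P ^ s)
        ≤ ((n : ℝ) + 1) ^ (s - 1) * (2 * ((n : ℝ) + 1)) * (x ^ c.length * P ^ s) := by gcongr
      _ = 2 * (((n : ℝ) + 1) ^ (s - 1) * ((n : ℝ) + 1)) * (x ^ c.length * P ^ s) := by ring
      _ = 2 * ((n : ℝ) + 1) ^ s * (x ^ c.length * P ^ s) := by rw [hpow]
  calc x ^ (c.length + 1) * (((c.length : ℝ) + 1) * P) ^ s +
        ∑ k : Fin c.length, x ^ c.length * (((c.partSize k : ℝ) + 1) * P) ^ s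
      ≤ x * ((n : ℝ) + 1) ^ s * (x ^ c.length * P ^ s) + 2 * ((n : ℝ) + 1) ^ s * (x ^ c.length * P ^ s) :=
        add_le_add h1 h2
    _ = (x + 2) * ((n : ℝ) + 1) ^ s * (x ^ c.length * P ^ s) := by ring

/-- **The Gevrey weight sum over ordered finpartitions**: `Σ_{c ∈ OFP(n)} x^{|c|} (|c|! ∏_i |c_i|!)^s ≤ (x+2)ⁿ (n!)^s`
for `s ≥ 1`, `x ≥ 0` — the combinatorial core of the stability of the Gevrey class `s` under composition («standard
rules for … composition of Gevrey functions (see [G])»). [cite: DisertoriRivasseau2000, App. A Lemma 12 p0017:L8–10] -/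
private theorem sum_orderedFinpartition_weight_le {s x : ℝ} (hs : 1 ≤ s) (hx : 0 ≤ x) (n : ℕ) :
    ∑ c : OrderedFinpartition n, x ^ c.length *
        ((((c.length ! : ℕ) : ℝ) * ∏ i, (((c.partSize i)! : ℕ) : ℝ))) ^ s ≤ (x + 2) ^ n * ((n ! : ℕ) : ℝ) ^ s := by
  induction n with
  | zero =>
    rw [Fintype.sum_unique]
    simp [OrderedFinpartition.default_eq]
  | succ n ih =>
    have hs0 : 0 ≤ s := by linarith
    have key : ∑ c : OrderedFinpartition (n + 1), x ^ c.length *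
        ((((c.length ! : ℕ) : ℝ) * ∏ i, (((c.partSize i)! : ℕ) : ℝ))) ^ s =
        ∑ c : OrderedFinpartition n, ∑ o : Option (Fin c.length), x ^ (c.extend o).length *
          ((((c.extend o).length ! : ℕ) : ℝ) * ∏ i, ((((c.extend o).partSize i)! : ℕ) : ℝ)) ^ s := by
      rw [Finset.sum_sigma']
      exact (Fintype.sum_equiv (OrderedFinpartition.extendEquiv n) _ _ (fun p => rfl)).symm
    rw [key]
    calc ∑ c : OrderedFinpartition n, ∑ o : Option (Fin c.length), x ^ (c.extend o).length *
          ((((c.extend o).length ! : ℕ) : ℝ) * ∏ i, ((((c.extend o).partSize i)! : ℕ) : ℝ)) ^ s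
        ≤ ∑ c : OrderedFinpartition n, (x + 2) * ((n : ℝ) + 1) ^ s *
            (x ^ c.length * ((((c.length ! : ℕ) : ℝ) * ∏ i, (((c.partSize i)! : ℕ) : ℝ))) ^ s) :=
          Finset.sum_le_sum fun c _ => sum_extend_weight_le hs hx c
      _ = (x + 2) * ((n : ℝ) + 1) ^ s * ∑ c : OrderedFinpartition n,
            x ^ c.length * ((((c.length ! : ℕ) : ℝ) * ∏ i, (((c.partSize i)! : ℕ) : ℝ))) ^ s := by
          rw [Finset.mul_sum]
      _ ≤ (x + 2) * ((n : ℝ) + 1) ^ s * ((x + 2) ^ n * ((n ! : ℕ) : ℝ) ^ s) := by gcongr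
      _ = (x + 2) ^ (n + 1) * ((((n : ℝ) + 1) * ((n ! : ℕ) : ℝ)) ^ s) := by
          rw [Real.mul_rpow (by positivity) (by positivity)]; ring
      _ = (x + 2) ^ (n + 1) * (((n + 1) ! : ℕ) : ℝ) ^ s := by
          rw [Nat.factorial_succ]; push_cast; ring

/-! ### 1b. Gevrey bounds at a point: composition, product, sum, constants, affine functions -/

/-- **Composition of Gevrey bounds** (one-variable Faà di Bruno): if `‖g^{(k)}(f x)‖ ≤ A C^k (k!)^s` for all `k` and
`‖f^{(i)}(x)‖ ≤ B D^i (i!)^s` for `i ≥ 1`, then `‖(g ∘ f)^{(n)}(x)‖ ≤ A (D(CB + 2))ⁿ (n!)^s` (`s ≥ 1`). This is the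
«standard rule for composition of Gevrey functions» the printed proof invokes. [cite: DisertoriRivasseau2000, App. A Lemma 12 p0017:L8–10] -/
private theorem gevrey_comp {F : Type*} [NormedAddCommGroup F] [NormedSpace ℝ F] {g : ℝ → F} {f : ℝ → ℝ} {x : ℝ}
    {s A C B D : ℝ} (hs : 1 ≤ s) (hA : 0 ≤ A) (hC : 0 ≤ C) (hB : 0 ≤ B) (hD : 0 ≤ D)
    (hg : ∀ k : ℕ, ContDiffAt ℝ k g (f x)) (hf : ∀ k : ℕ, ContDiffAt ℝ k f x)
    (hgb : ∀ k : ℕ, ‖iteratedDeriv k g (f x)‖ ≤ A * C ^ k * ((k ! : ℕ) : ℝ) ^ s)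
    (hfb : ∀ i : ℕ, 1 ≤ i → ‖iteratedDeriv i f x‖ ≤ B * D ^ i * ((i ! : ℕ) : ℝ) ^ s) (n : ℕ) :
    ‖iteratedDeriv n (g ∘ f) x‖ ≤ A * (D * (C * B + 2)) ^ n * ((n ! : ℕ) : ℝ) ^ s := by
  rw [iteratedDeriv_scomp_eq_sum_orderedFinpartition (hg n) (hf n) le_rfl]
  have hterm : ∀ c : OrderedFinpartition n,
      ‖(∏ j, iteratedDeriv (c.partSize j) f x) • iteratedDeriv c.length g (f x)‖ ≤
        A * D ^ n * ((C * B) ^ c.length * ((((c.length ! : ℕ) : ℝ) * ∏ i, (((c.partSize i)! : ℕ) : ℝ))) ^ s) := by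
    intro c
    rw [norm_smul, norm_prod]
    have h1 : ∏ j, ‖iteratedDeriv (c.partSize j) f x‖ ≤ ∏ j, (B * D ^ (c.partSize j) * (((c.partSize j)! : ℕ) : ℝ) ^ s) :=
      Finset.prod_le_prod (fun j _ => norm_nonneg _) (fun j _ => hfb _ (c.partSize_pos j))
    have h2 := hgb c.length
    have hprod : (∏ j, (B * D ^ (c.partSize j) * (((c.partSize j)! : ℕ) : ℝ) ^ s)) * (A * C ^ c.length * ((c.length ! : ℕ) : ℝ) ^ s) =
        A * D ^ n * ((C * B) ^ c.length * ((((c.length ! : ℕ) : ℝ) * ∏ i, (((c.partSize i)! : ℕ) : ℝ))) ^ s) := by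
      rw [Finset.prod_mul_distrib, Finset.prod_mul_distrib, Finset.prod_const, Finset.card_univ, Fintype.card_fin,
        Finset.prod_pow_eq_pow_sum, sum_partSize,
        Real.finsetProd_rpow _ _ (fun i _ => by positivity), Real.mul_rpow (by positivity) (by positivity), mul_pow]
      ring
    calc (∏ j, ‖iteratedDeriv (c.partSize j) f x‖) * ‖iteratedDeriv c.length g (f x)‖
        ≤ (∏ j, (B * D ^ (c.partSize j) * (((c.partSize j)! : ℕ) : ℝ) ^ s)) * (A * C ^ c.length * ((c.length ! : ℕ) : ℝ) ^ s) :=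
          mul_le_mul h1 h2 (norm_nonneg _) (Finset.prod_nonneg fun j _ => by positivity)
      _ = _ := hprod
  calc ‖∑ c : OrderedFinpartition n, (∏ j, iteratedDeriv (c.partSize j) f x) • iteratedDeriv c.length g (f x)‖
      ≤ ∑ c : OrderedFinpartition n, ‖(∏ j, iteratedDeriv (c.partSize j) f x) • iteratedDeriv c.length g (f x)‖ :=
        norm_sum_le _ _
    _ ≤ ∑ c : OrderedFinpartition n,
          A * D ^ n * ((C * B) ^ c.length * ((((c.length ! : ℕ) : ℝ) * ∏ i, (((c.partSize i)! : ℕ) : ℝ))) ^ s) :=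
        Finset.sum_le_sum fun c _ => hterm c
    _ = A * D ^ n * ∑ c : OrderedFinpartition n,
          (C * B) ^ c.length * ((((c.length ! : ℕ) : ℝ) * ∏ i, (((c.partSize i)! : ℕ) : ℝ))) ^ s := by
        rw [Finset.mul_sum]
    _ ≤ A * D ^ n * ((C * B + 2) ^ n * ((n ! : ℕ) : ℝ) ^ s) := by
        gcongr
        exact sum_orderedFinpartition_weight_le hs (by positivity) n
    _ = A * (D * (C * B + 2)) ^ n * ((n ! : ℕ) : ℝ) ^ s := by rw [mul_pow]; ring

/-- `C(n,i) (i!(n-i)!)^s ≤ (n!)^s` for `s ≥ 1` (the Leibniz weights). [folklore] -/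
private theorem choose_mul_rpow_le {s : ℝ} (hs : 1 ≤ s) {n i : ℕ} (hi : i ≤ n) :
    (n.choose i : ℝ) * ((((i ! : ℕ) : ℝ) * (((n - i)! : ℕ) : ℝ))) ^ s ≤ ((n ! : ℕ) : ℝ) ^ s := by
  set q : ℝ := ((i ! : ℕ) : ℝ) * (((n - i)! : ℕ) : ℝ) with hq
  have hq0 : 0 < q := by positivity
  have hqn : q ≤ ((n ! : ℕ) : ℝ) := by
    rw [hq]
    exact_mod_cast Nat.le_of_dvd (Nat.factorial_pos n) (Nat.factorial_mul_factorial_dvd_factorial hi)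
  have hcq : (n.choose i : ℝ) * q = ((n ! : ℕ) : ℝ) := by
    rw [hq, ← mul_assoc]
    exact_mod_cast Nat.choose_mul_factorial_mul_factorial hi
  have hsplit : q ^ s = q * q ^ (s - 1) := by
    conv_lhs => rw [show s = 1 + (s - 1) by ring, Real.rpow_add hq0, Real.rpow_one]
  have hsplit' : ((n ! : ℕ) : ℝ) ^ s = ((n ! : ℕ) : ℝ) * ((n ! : ℕ) : ℝ) ^ (s - 1) := by
    conv_lhs => rw [show s = 1 + (s - 1) by ring, Real.rpow_add (by positivity), Real.rpow_one]
  rw [hsplit, ← mul_assoc, hcq, hsplit']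
  exact mul_le_mul_of_nonneg_left (Real.rpow_le_rpow hq0.le hqn (by linarith)) (by positivity)

/-- **Product of Gevrey bounds** (Leibniz, for functions smooth on an open set around the point): bounds `A C^i (i!)^s`
and `B D^i (i!)^s` give `AB (C+D)ⁿ (n!)^s` («standard rule for … product»). [cite: DisertoriRivasseau2000, App. A Lemma 12 p0017:L8–10] -/
private theorem gevrey_mul {𝔸 : Type*} [NormedRing 𝔸] [NormedAlgebra ℝ 𝔸] {f g : ℝ → 𝔸} {U : Set ℝ} (hU : IsOpen U)
    {x : ℝ} (hx : x ∈ U) (hf : ContDiffOn ℝ ∞ f U) (hg : ContDiffOn ℝ ∞ g U) {s A B C D : ℝ} (hs : 1 ≤ s)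
    (hC : 0 ≤ C) (hD : 0 ≤ D) (hfb : ∀ i : ℕ, ‖iteratedDeriv i f x‖ ≤ A * C ^ i * ((i ! : ℕ) : ℝ) ^ s)
    (hgb : ∀ i : ℕ, ‖iteratedDeriv i g x‖ ≤ B * D ^ i * ((i ! : ℕ) : ℝ) ^ s) (n : ℕ) :
    ‖iteratedDeriv n (fun y => f y * g y) x‖ ≤ A * B * (C + D) ^ n * ((n ! : ℕ) : ℝ) ^ s := by
  have hA : 0 ≤ A := by have h := hfb 0; simp at h; exact (norm_nonneg _).trans h
  have hB : 0 ≤ B := by have h := hgb 0; simp at h; exact (norm_nonneg _).trans h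
  have h := norm_iteratedFDerivWithin_mul_le (N := (n : ℕ∞ω)) (hf.of_le (by exact_mod_cast le_top))
    (hg.of_le (by exact_mod_cast le_top)) hU.uniqueDiffOn hx le_rfl
  rw [iteratedFDerivWithin_of_isOpen n hU hx, norm_iteratedFDeriv_eq_norm_iteratedDeriv] at h
  refine h.trans ?_
  have hterm : ∀ i ∈ Finset.range (n + 1), (n.choose i : ℝ) * ‖iteratedFDerivWithin ℝ i f U x‖ *
      ‖iteratedFDerivWithin ℝ (n - i) g U x‖ ≤ A * B * ((n ! : ℕ) : ℝ) ^ s * (C ^ i * D ^ (n - i) * (n.choose i : ℝ)) := by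
    intro i hi
    have hin : i ≤ n := Nat.lt_succ_iff.1 (Finset.mem_range.1 hi)
    have hch : (1 : ℝ) ≤ (n.choose i : ℝ) := by exact_mod_cast Nat.choose_pos hin
    rw [iteratedFDerivWithin_of_isOpen i hU hx, iteratedFDerivWithin_of_isOpen (n - i) hU hx,
      norm_iteratedFDeriv_eq_norm_iteratedDeriv, norm_iteratedFDeriv_eq_norm_iteratedDeriv]
    calc (n.choose i : ℝ) * ‖iteratedDeriv i f x‖ * ‖iteratedDeriv (n - i) g x‖
        ≤ (n.choose i : ℝ) * (A * C ^ i * ((i ! : ℕ) : ℝ) ^ s) * (B * D ^ (n - i) * (((n - i)! : ℕ) : ℝ) ^ s) := by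
          gcongr
          · exact hfb i
          · exact hgb (n - i)
      _ = A * B * (C ^ i * D ^ (n - i)) * ((n.choose i : ℝ) * ((((i ! : ℕ) : ℝ) * (((n - i)! : ℕ) : ℝ))) ^ s) := by
          rw [Real.mul_rpow (by positivity) (by positivity)]; ring
      _ ≤ A * B * (C ^ i * D ^ (n - i)) * ((n ! : ℕ) : ℝ) ^ s := by
          gcongr
          exact choose_mul_rpow_le hs hin
      _ = A * B * ((n ! : ℕ) : ℝ) ^ s * (C ^ i * D ^ (n - i) * 1) := by ring
      _ ≤ A * B * ((n ! : ℕ) : ℝ) ^ s * (C ^ i * D ^ (n - i) * (n.choose i : ℝ)) := by gcongr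
  calc ∑ i ∈ Finset.range (n + 1), (n.choose i : ℝ) * ‖iteratedFDerivWithin ℝ i f U x‖ * ‖iteratedFDerivWithin ℝ (n - i) g U x‖
      ≤ ∑ i ∈ Finset.range (n + 1), A * B * ((n ! : ℕ) : ℝ) ^ s * (C ^ i * D ^ (n - i) * (n.choose i : ℝ)) :=
        Finset.sum_le_sum hterm
    _ = A * B * ((n ! : ℕ) : ℝ) ^ s * (C + D) ^ n := by rw [← Finset.mul_sum, add_pow]
    _ = A * B * (C + D) ^ n * ((n ! : ℕ) : ℝ) ^ s := by ring

/-- Squares (a product with itself). [folklore] -/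
private theorem gevrey_sq {𝔸 : Type*} [NormedRing 𝔸] [NormedAlgebra ℝ 𝔸] {f : ℝ → 𝔸} (hf : ContDiff ℝ ∞ f) {x : ℝ}
    {s A C : ℝ} (hs : 1 ≤ s) (hC : 0 ≤ C) (hfb : ∀ i : ℕ, ‖iteratedDeriv i f x‖ ≤ A * C ^ i * ((i ! : ℕ) : ℝ) ^ s)
    (n : ℕ) : ‖iteratedDeriv n (fun y => f y ^ 2) x‖ ≤ A * A * (C + C) ^ n * ((n ! : ℕ) : ℝ) ^ s := by
  have h : (fun y => f y ^ 2) = fun y => f y * f y := by funext y; rw [sq]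
  rw [h]
  exact gevrey_mul isOpen_univ (mem_univ x) hf.contDiffOn hf.contDiffOn hs hC hC hfb hfb n

/-- **Sum of Gevrey bounds**. [folklore] -/
private theorem gevrey_add {F : Type*} [NormedAddCommGroup F] [NormedSpace ℝ F] {f g : ℝ → F} {x : ℝ}
    (hf : ∀ k : ℕ, ContDiffAt ℝ k f x) (hg : ∀ k : ℕ, ContDiffAt ℝ k g x) {s A B C D : ℝ} (hC : 0 ≤ C) (hD : 0 ≤ D)
    (hfb : ∀ i : ℕ, ‖iteratedDeriv i f x‖ ≤ A * C ^ i * ((i ! : ℕ) : ℝ) ^ s)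
    (hgb : ∀ i : ℕ, ‖iteratedDeriv i g x‖ ≤ B * D ^ i * ((i ! : ℕ) : ℝ) ^ s) (n : ℕ) :
    ‖iteratedDeriv n (fun y => f y + g y) x‖ ≤ (A + B) * (C + D) ^ n * ((n ! : ℕ) : ℝ) ^ s := by
  have hA : 0 ≤ A := by have h := hfb 0; simp at h; exact (norm_nonneg _).trans h
  have hB : 0 ≤ B := by have h := hgb 0; simp at h; exact (norm_nonneg _).trans h
  rw [iteratedDeriv_fun_add (hf n) (hg n)]
  calc ‖iteratedDeriv n f x + iteratedDeriv n g x‖ ≤ ‖iteratedDeriv n f x‖ + ‖iteratedDeriv n g x‖ := norm_add_le _ _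
    _ ≤ A * C ^ n * ((n ! : ℕ) : ℝ) ^ s + B * D ^ n * ((n ! : ℕ) : ℝ) ^ s := add_le_add (hfb n) (hgb n)
    _ ≤ A * (C + D) ^ n * ((n ! : ℕ) : ℝ) ^ s + B * (C + D) ^ n * ((n ! : ℕ) : ℝ) ^ s := by
        gcongr
        · linarith
        · linarith
    _ = (A + B) * (C + D) ^ n * ((n ! : ℕ) : ℝ) ^ s := by ring

/-- **Monotonicity** of Gevrey bounds in the constants. [folklore] -/
private theorem gevrey_mono {F : Type*} [NormedAddCommGroup F] [NormedSpace ℝ F] {f : ℝ → F} {x : ℝ}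
    {s A A' C C' : ℝ} (hC : 0 ≤ C) (hAA : A ≤ A') (hCC : C ≤ C')
    (hfb : ∀ i : ℕ, ‖iteratedDeriv i f x‖ ≤ A * C ^ i * ((i ! : ℕ) : ℝ) ^ s) (n : ℕ) :
    ‖iteratedDeriv n f x‖ ≤ A' * C' ^ n * ((n ! : ℕ) : ℝ) ^ s := by
  have hA : 0 ≤ A := by have h := hfb 0; simp at h; exact (norm_nonneg _).trans h
  calc ‖iteratedDeriv n f x‖ ≤ A * C ^ n * ((n ! : ℕ) : ℝ) ^ s := hfb n
    _ ≤ A' * C' ^ n * ((n ! : ℕ) : ℝ) ^ s := by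
        gcongr
        exact hA.trans hAA

/-- **Constants**: `‖c‖ ≤ A` gives the bounds `A · 0ⁿ · (n!)^s`. [folklore] -/
private theorem gevrey_const {F : Type*} [NormedAddCommGroup F] [NormedSpace ℝ F] {c : F} {A : ℝ} (hc : ‖c‖ ≤ A)
    (x : ℝ) {s : ℝ} (n : ℕ) : ‖iteratedDeriv n (fun _ : ℝ => c) x‖ ≤ A * 0 ^ n * ((n ! : ℕ) : ℝ) ^ s := by
  rw [iteratedDeriv_const]
  split_ifs with h
  · subst h
    have h1 : (1 : ℝ) ≤ ((0 ! : ℕ) : ℝ) ^ s := by simp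
    simpa using hc.trans (le_mul_of_one_le_right ((norm_nonneg _).trans hc) h1)
  · rw [norm_zero]
    exact mul_nonneg (mul_nonneg ((norm_nonneg _).trans hc) (pow_nonneg le_rfl _)) (by positivity)

/-- **Affine functions** at `0`: `τ ↦ p + τ q` with `|p|, |q| ≤ A` has the bounds `A · 1ⁿ · (n!)^s`. [folklore] -/
private theorem gevrey_affine {p q A : ℝ} (hp : |p| ≤ A) (hq : |q| ≤ A) {s : ℝ} (hs : 0 ≤ s) (n : ℕ) :
    ‖iteratedDeriv n (fun τ : ℝ => p + τ * q) 0‖ ≤ A * 1 ^ n * ((n ! : ℕ) : ℝ) ^ s := by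
  have hA : 0 ≤ A := (abs_nonneg p).trans hp
  rw [one_pow, mul_one]
  have hd : deriv (fun τ : ℝ => p + τ * q) = fun _ => q := by
    funext τ
    simp
  rcases n with _ | n
  · simp only [iteratedDeriv_zero, zero_mul, add_zero, Real.norm_eq_abs]
    calc |p| ≤ A := hp
      _ ≤ A * ((0 ! : ℕ) : ℝ) ^ s := by simp
  · rw [iteratedDeriv_succ', hd, iteratedDeriv_const]
    split_ifs with h
    · rw [Real.norm_eq_abs]
      have h1 : (1 : ℝ) ≤ (((n + 1)! : ℕ) : ℝ) ^ s :=
        Real.one_le_rpow (by exact_mod_cast Nat.one_le_of_lt (Nat.factorial_pos _)) hs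
      calc |q| ≤ A := hq
        _ = A * 1 := (mul_one A).symm
        _ ≤ A * (((n + 1)! : ℕ) : ℝ) ^ s := by gcongr
    · rw [norm_zero]; positivity

/-- **Real factors as complex ones**: the norms of the iterated derivatives agree. [folklore] -/
private theorem norm_iteratedDeriv_ofReal {f : ℝ → ℝ} {x : ℝ} {n : ℕ} (hf : ContDiffAt ℝ n f x) :
    ‖iteratedDeriv n (fun y => ((f y : ℝ) : ℂ)) x‖ = ‖iteratedDeriv n f x‖ := by
  have h := ContinuousLinearMap.iteratedFDeriv_comp_left (i := n) ofRealCLM hf le_rfl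
  have hcomp : (fun y => ((f y : ℝ) : ℂ)) = ofRealCLM ∘ f := by
    funext y; simp [ofRealCLM_apply]
  rw [iteratedDeriv_eq_iteratedFDeriv, iteratedDeriv_eq_iteratedFDeriv, hcomp, h,
    ContinuousLinearMap.compContinuousMultilinearMap_coe, Function.comp_apply, ofRealCLM_apply, Complex.norm_real]

/-- **The rescaled relative angle along a line**: for `Re a ≥ 2/5`, `‖b‖ ≤ 2σ`, `0 < σ ≤ 1`, the function
`τ ↦ arg(a + τ b)/σ` has `‖∂^i‖ ≤ 1 · 5^i · (i!)^s` at `0` for `i ≥ 1` (`s ≥ 1`) — UNIFORMLY in `σ`: each derivative of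
the angle costs `‖b‖ ≤ 2σ` (tree file `ArgAffineLineDerivatives`: `‖∂^i arg(a + τb)‖ ≤ (i−1)! ‖b‖^i/‖a + τb‖^i`), which
pays for the sector width `1/σ`.  This is the printed `α_q^{1/4}` per tangential derivative. [cite: DisertoriRivasseau2000, App. A Lemma 12 p0017:L11–21] -/
private theorem gevrey_arg_line {a b : ℂ} {σ s : ℝ} (hσ : 0 < σ) (hσ1 : σ ≤ 1) (hs : 1 ≤ s) (ha : 2 / 5 ≤ a.re)
    (hb : ‖b‖ ≤ 2 * σ) (i : ℕ) (hi : 1 ≤ i) :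
    ‖iteratedDeriv i (fun τ : ℝ => σ⁻¹ * arg (a + (τ : ℂ) * b)) 0‖ ≤ 1 * 5 ^ i * ((i ! : ℕ) : ℝ) ^ s := by
  obtain ⟨j, rfl⟩ : ∃ j, i = j + 1 := ⟨i - 1, by omega⟩
  have hslit : a + ((0 : ℝ) : ℂ) * b ∈ slitPlane := by
    simp only [Complex.ofReal_zero, zero_mul, add_zero]
    exact Or.inl (by linarith)
  have ha' : 2 / 5 ≤ ‖a‖ := ha.trans (Complex.re_le_norm a)
  rw [iteratedDeriv_const_mul_field, norm_mul, norm_inv, Real.norm_eq_abs, abs_of_pos hσ]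
  have h := norm_iteratedDeriv_arg_affine_le a b j hslit
  simp only [Complex.ofReal_zero, zero_mul, add_zero] at h
  have hj : ((j ! : ℕ) : ℝ) ≤ (((j + 1)! : ℕ) : ℝ) := by exact_mod_cast Nat.factorial_le (Nat.le_succ j)
  have hfac1 : (1 : ℝ) ≤ (((j + 1)! : ℕ) : ℝ) := by exact_mod_cast Nat.one_le_of_lt (Nat.factorial_pos _)
  have hfacs : (((j + 1)! : ℕ) : ℝ) ≤ (((j + 1)! : ℕ) : ℝ) ^ s := by
    conv_lhs => rw [← Real.rpow_one (((j + 1)! : ℕ) : ℝ)]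
    exact Real.rpow_le_rpow_of_exponent_le hfac1 hs
  have hpow : ‖b‖ ^ (j + 1) / ‖a‖ ^ (j + 1) ≤ 5 ^ (j + 1) * σ := by
    rw [div_le_iff₀ (by positivity)]
    have h25 : (2 : ℝ) ≤ 5 * ‖a‖ := by linarith
    calc ‖b‖ ^ (j + 1) ≤ (2 * σ) ^ (j + 1) := pow_le_pow_left₀ (norm_nonneg _) hb _
      _ = 2 ^ (j + 1) * (σ ^ j * σ) := by rw [mul_pow, pow_succ σ j]
      _ ≤ 2 ^ (j + 1) * (1 * σ) := by gcongr; exact pow_le_one₀ hσ.le hσ1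
      _ ≤ (5 * ‖a‖) ^ (j + 1) * (1 * σ) := by gcongr
      _ = 5 ^ (j + 1) * σ * ‖a‖ ^ (j + 1) := by rw [mul_pow]; ring
  calc σ⁻¹ * ‖iteratedDeriv (j + 1) (fun τ : ℝ => arg (a + (τ : ℂ) * b)) 0‖
      ≤ σ⁻¹ * ((j ! : ℝ) * ‖b‖ ^ (j + 1) / ‖a‖ ^ (j + 1)) := mul_le_mul_of_nonneg_left h (inv_pos.2 hσ).le
    _ = σ⁻¹ * (j ! : ℝ) * (‖b‖ ^ (j + 1) / ‖a‖ ^ (j + 1)) := by ring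
    _ ≤ σ⁻¹ * (j ! : ℝ) * (5 ^ (j + 1) * σ) := mul_le_mul_of_nonneg_left hpow (by positivity)
    _ = (j ! : ℝ) * 5 ^ (j + 1) := by field_simp
    _ ≤ (((j + 1)! : ℕ) : ℝ) ^ s * 5 ^ (j + 1) := by gcongr; exact hj.trans hfacs
    _ = 1 * 5 ^ (j + 1) * (((j + 1)! : ℕ) : ℝ) ^ s := by ring

/-! ## 2. Sup-norm Gevrey bounds of the cutoff and of its derivative from the `L¹` Gevrey class (II.14) -/

/-- A cutoff vanishes with all its derivatives off `[-1/2, 1/2]`. [cite: DisertoriRivasseau2000, §II.2 (II.13) p0004:L12–16] -/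
private theorem iteratedDeriv_cutoff_eq_zero {u : ℝ → ℝ} (hu : IsCutoff u) (k : ℕ) {y : ℝ} (hy : 1 / 2 < |y|) :
    iteratedDeriv k u y = 0 := by
  have hev : u =ᶠ[𝓝 y] (fun _ => (0 : ℝ)) := by
    have hopen : IsOpen {r : ℝ | 1 / 2 < |r|} := isOpen_lt continuous_const continuous_abs
    filter_upwards [hopen.mem_nhds hy] with r hr
    exact hu.eq_zero r hr
  rw [Filter.EventuallyEq.iteratedDeriv_eq k hev, iteratedDeriv_const]
  split_ifs <;> rfl

/-- In particular `u' = 0` off `[-1/2, 1/2]`. [cite: DisertoriRivasseau2000, §II.2 (II.13) p0004:L12–16] -/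
private theorem deriv_cutoff_eq_zero {u : ℝ → ℝ} (hu : IsCutoff u) {r : ℝ} (hr : 1 / 2 < |r|) : deriv u r = 0 := by
  have h := iteratedDeriv_cutoff_eq_zero hu 1 hr
  rwa [iteratedDeriv_one] at h

/-- `u'` is smooth. [folklore] -/
private theorem contDiff_deriv_cutoff {u : ℝ → ℝ} (hu : IsCutoff u) : ContDiff ℝ ∞ (deriv u) := by
  have h := hu.smooth.iterate_deriv 1
  rwa [Function.iterate_one] at h

/-- All derivatives of a cutoff have compact support. [folklore] -/
private theorem hasCompactSupport_iteratedDeriv_cutoff {u : ℝ → ℝ} (hu : IsCutoff u) (k : ℕ) :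
    HasCompactSupport (iteratedDeriv k u) := by
  refine HasCompactSupport.intro (isCompact_Icc : IsCompact (Icc (-(1 / 2 : ℝ)) (1 / 2))) fun r hr => ?_
  apply iteratedDeriv_cutoff_eq_zero hu k
  simp only [mem_Icc, not_and_or, not_le] at hr
  rcases hr with h | h
  · rw [abs_of_neg (by linarith)]; linarith
  · rw [abs_of_pos (by linarith)]; linarith

/-- The sup norm of a derivative is at most the `L¹` norm of the next one (fundamental theorem of calculus from a point
where the cutoff vanishes). [folklore] -/
private theorem abs_iteratedDeriv_le_integral {u : ℝ → ℝ} (hu : IsCutoff u) (k : ℕ) (y : ℝ) :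
    |iteratedDeriv k u y| ≤ ∫ r, |iteratedDeriv (k + 1) u r| := by
  set a : ℝ := -(|y| + 1) with ha
  have hay : a ≤ y := by rw [ha]; linarith [neg_abs_le y]
  have hga : iteratedDeriv k u a = 0 :=
    iteratedDeriv_cutoff_eq_zero hu k (by rw [ha, abs_neg, abs_of_pos (by positivity)]; linarith [abs_nonneg y])
  have hdiff : Differentiable ℝ (iteratedDeriv k u) :=
    hu.smooth.differentiable_iteratedDeriv k (WithTop.coe_lt_coe.2 (ENat.coe_lt_top k))
  have hderiv : ∀ x, HasDerivAt (iteratedDeriv k u) (iteratedDeriv (k + 1) u x) x := fun x => by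
    rw [iteratedDeriv_succ]; exact (hdiff x).hasDerivAt
  have hcont : Continuous (iteratedDeriv (k + 1) u) :=
    hu.smooth.continuous_iteratedDeriv (k + 1) (by exact_mod_cast le_top)
  have hftc := intervalIntegral.integral_eq_sub_of_hasDerivAt (fun x _ => hderiv x) (hcont.intervalIntegrable a y)
  rw [hga, sub_zero] at hftc
  rw [← hftc]
  have hint : Integrable (fun r => |iteratedDeriv (k + 1) u r|) :=
    (hcont.integrable_of_hasCompactSupport (hasCompactSupport_iteratedDeriv_cutoff hu (k + 1))).abs
  calc |∫ x in a..y, iteratedDeriv (k + 1) u x| ≤ ∫ x in a..y, |iteratedDeriv (k + 1) u x| :=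
        intervalIntegral.abs_integral_le_integral_abs hay
    _ = ∫ x in Ioc a y, |iteratedDeriv (k + 1) u x| := intervalIntegral.integral_of_le hay
    _ ≤ ∫ r, |iteratedDeriv (k + 1) u r| := setIntegral_le_integral hint (Eventually.of_forall fun r => abs_nonneg _)

/-- `(n/e)^{n s} ≤ (n!)^s` (from `n^n/n! ≤ e^n`) — the Stirling step of the footnote to (II.14).
[cite: DisertoriRivasseau2000, §II.2 (II.14) p0004:L18–26] -/
private theorem div_exp_rpow_le_factorial_rpow (n : ℕ) {s : ℝ} (hs : 0 ≤ s) :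
    ((n : ℝ) / Real.exp 1) ^ ((n : ℝ) * s) ≤ ((n ! : ℕ) : ℝ) ^ s := by
  have h0 : 0 ≤ (n : ℝ) / Real.exp 1 := by positivity
  rw [Real.rpow_mul h0, Real.rpow_natCast]
  refine Real.rpow_le_rpow (by positivity) ?_ hs
  rw [div_pow, Real.exp_one_pow, div_le_iff₀ (Real.exp_pos _)]
  have h := Real.pow_div_factorial_le_exp (x := (n : ℝ)) (Nat.cast_nonneg n) n
  rw [div_le_iff₀ (by positivity)] at h
  linarith

/-- `((k+1)!)^s ≤ (2^s)^k (k!)^s`. [folklore] -/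
private theorem factorial_succ_rpow_le (k : ℕ) {s : ℝ} (hs : 0 ≤ s) :
    ((((k + 1)! : ℕ) : ℝ)) ^ s ≤ ((2 : ℝ) ^ s) ^ k * ((k ! : ℕ) : ℝ) ^ s := by
  have h1 : (((k + 1)! : ℕ) : ℝ) ≤ (2 : ℝ) ^ k * ((k ! : ℕ) : ℝ) := by
    rw [Nat.factorial_succ]
    push_cast
    have : (k : ℝ) + 1 ≤ (2 : ℝ) ^ k := by exact_mod_cast Nat.lt_two_pow_self
    exact mul_le_mul_of_nonneg_right this (by positivity)
  calc ((((k + 1)! : ℕ) : ℝ)) ^ s ≤ ((2 : ℝ) ^ k * ((k ! : ℕ) : ℝ)) ^ s := Real.rpow_le_rpow (by positivity) h1 hs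
    _ = ((2 : ℝ) ^ s) ^ k * ((k ! : ℕ) : ℝ) ^ s := by
        rw [Real.mul_rpow (by positivity) (by positivity), ← Real.rpow_natCast, ← Real.rpow_mul (by norm_num),
          mul_comm (k : ℝ) s, Real.rpow_mul (by norm_num), Real.rpow_natCast]

/-- **Sup-norm Gevrey bounds of the cutoff**: `|u^{(k)}(y)| ≤ (A/μ) (2^s/μ)^k (k!)^s` for a cutoff of the class (II.14).
[cite: DisertoriRivasseau2000, §II.2 (II.14) p0004:L18–26] -/
private theorem abs_iteratedDeriv_cutoff_le {u : ℝ → ℝ} (hu : IsCutoff u) {s A μ : ℝ} (hs : 1 ≤ s)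
    (hG : IsGevreyL1 s A μ u) (k : ℕ) (y : ℝ) :
    |iteratedDeriv k u y| ≤ A / μ * (2 ^ s / μ) ^ k * ((k ! : ℕ) : ℝ) ^ s := by
  obtain ⟨hA, hμ, hL1⟩ := hG
  have hs0 : 0 ≤ s := by linarith
  have h1 := abs_iteratedDeriv_le_integral hu k y
  have h2 := hL1 (k + 1)
  have h3 := div_exp_rpow_le_factorial_rpow (k + 1) hs0
  have h4 := factorial_succ_rpow_le k hs0
  have hz : μ ^ (-((k + 1 : ℕ) : ℤ)) = μ⁻¹ * μ⁻¹ ^ k := by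
    rw [zpow_neg, zpow_natCast, ← inv_pow, pow_succ, mul_comm]
  calc |iteratedDeriv k u y| ≤ ∫ r, |iteratedDeriv (k + 1) u r| := h1
    _ ≤ A * μ ^ (-((k + 1 : ℕ) : ℤ)) * (((k + 1 : ℕ) : ℝ) / Real.exp 1) ^ (((k + 1 : ℕ) : ℝ) * s) := h2
    _ ≤ A * μ ^ (-((k + 1 : ℕ) : ℤ)) * (((2 : ℝ) ^ s) ^ k * ((k ! : ℕ) : ℝ) ^ s) := by gcongr; exact h3.trans h4
    _ = A / μ * (2 ^ s / μ) ^ k * ((k ! : ℕ) : ℝ) ^ s := by rw [hz, div_pow, div_eq_mul_inv, div_eq_mul_inv, ← inv_pow]; ring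

/-- **One pair of Gevrey constants for `u` and `u'`** (as complex-valued functions): there are `A₁, C₁ > 0` with
`‖∂^k u‖_∞ ≤ A₁ C₁^k (k!)^s` and `‖∂^k u'‖_∞ ≤ A₁ C₁^k (k!)^s` — «u(x) is a Gevrey function of class s».
[cite: DisertoriRivasseau2000, App. A Lemma 12 p0017:L1–2] -/
private theorem exists_gevrey_sup_cutoff {u : ℝ → ℝ} (hu : IsCutoff u) {s A μ : ℝ} (hs : 1 ≤ s) (hG : IsGevreyL1 s A μ u) :
    ∃ A₁ C₁ : ℝ, 0 < A₁ ∧ 0 < C₁ ∧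
      (∀ (k : ℕ) (y : ℝ), ‖iteratedDeriv k (fun r => ((u r : ℝ) : ℂ)) y‖ ≤ A₁ * C₁ ^ k * ((k ! : ℕ) : ℝ) ^ s) ∧
      (∀ (k : ℕ) (y : ℝ), ‖iteratedDeriv k (fun r => ((deriv u r : ℝ) : ℂ)) y‖ ≤ A₁ * C₁ ^ k * ((k ! : ℕ) : ℝ) ^ s) := by
  have hA : 0 < A := hG.1
  have hμ : 0 < μ := hG.2.1
  have hs0 : 0 ≤ s := by linarith
  set C₀ : ℝ := 2 ^ s / μ with hC₀
  have hC₀ : 0 < C₀ := by positivity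
  have h2s : (1 : ℝ) ≤ 2 ^ s := Real.one_le_rpow (by norm_num) hs0
  have hC₀le : C₀ ≤ 2 ^ s * C₀ := le_mul_of_one_le_left hC₀.le h2s
  have hAle : A / μ ≤ A / μ * (1 + C₀) := le_mul_of_one_le_right (by positivity) (by linarith)
  refine ⟨A / μ * (1 + C₀), 2 ^ s * C₀, by positivity, by positivity, fun k y => ?_, fun k y => ?_⟩
  · rw [norm_iteratedDeriv_ofReal ((hu.smooth.of_le (by exact_mod_cast le_top)).contDiffAt), Real.norm_eq_abs]
    calc |iteratedDeriv k u y| ≤ A / μ * C₀ ^ k * ((k ! : ℕ) : ℝ) ^ s := abs_iteratedDeriv_cutoff_le hu hs hG k y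
      _ ≤ A / μ * (1 + C₀) * (2 ^ s * C₀) ^ k * ((k ! : ℕ) : ℝ) ^ s := by gcongr
  · rw [norm_iteratedDeriv_ofReal (((contDiff_deriv_cutoff hu).of_le (by exact_mod_cast le_top)).contDiffAt),
      Real.norm_eq_abs, ← iteratedDeriv_succ']
    calc |iteratedDeriv (k + 1) u y| ≤ A / μ * C₀ ^ (k + 1) * (((k + 1)! : ℕ) : ℝ) ^ s :=
          abs_iteratedDeriv_cutoff_le hu hs hG (k + 1) y
      _ ≤ A / μ * C₀ ^ (k + 1) * (((2 : ℝ) ^ s) ^ k * ((k ! : ℕ) : ℝ) ^ s) := by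
          gcongr; exact factorial_succ_rpow_le k hs0
      _ = A / μ * C₀ * (2 ^ s * C₀) ^ k * ((k ! : ℕ) : ℝ) ^ s := by rw [pow_succ, mul_pow]; ring
      _ ≤ A / μ * (1 + C₀) * (2 ^ s * C₀) ^ k * ((k ! : ℕ) : ℝ) ^ s := by gcongr; linarith

/-! ## 3. The sector chart (as in the Lemma 5 proof file) and the normalized symbol `N_σ` -/

/-- Shift invariance of the periodisation: `u_p(y + nτ) = u_p(y)`. [cite: DisertoriRivasseau2000, §III.3.1 p0009:L66–70] -/
private theorem periodise_add_int_mul (u : ℝ → ℝ) (τ y : ℝ) (n : ℤ) :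
    periodise u τ (y + n * τ) = periodise u τ y := by
  unfold periodise
  have h : (fun m : ℤ => u (y + n * τ - m * τ)) = fun m : ℤ => (fun m' : ℤ => u (y - m' * τ)) (Equiv.subRight n m) := by
    funext m
    simp only [Equiv.subRight_apply, Int.cast_sub]
    ring_nf
  rw [h]
  exact (Equiv.subRight n).tsum_eq fun m' : ℤ => u (y - m' * τ)

/-- For a period `τ > 1`, on `|y| ≤ τ/2` only the central translate survives. [cite: DisertoriRivasseau2000, §III.3.1 p0009:L66–70] -/
private theorem periodise_eq_of_abs_le {u : ℝ → ℝ} (hu : IsCutoff u) {τ y : ℝ} (hτ : 1 < τ) (hy : |y| ≤ τ / 2) :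
    periodise u τ y = u y := by
  unfold periodise
  rw [tsum_eq_single 0]
  · simp
  · intro m hm
    apply hu.eq_zero
    have h1 : (1 : ℝ) ≤ |(m : ℝ)| := by exact_mod_cast Int.one_le_abs hm
    have h2 : τ ≤ |(m : ℝ) * τ| := by
      rw [abs_mul, abs_of_pos (show (0 : ℝ) < τ by linarith)]; nlinarith
    have h3 := abs_sub_abs_le_abs_sub ((m : ℝ) * τ) y
    rw [abs_sub_comm] at h3
    linarith

/-- The chart point `(1 + s²t₁) e(θ) + s t₂ τ(θ)` as a complex number is `e^{iθ} · U`, `U = (1 + s²t₁) + i s t₂`. [folklore] -/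
private theorem momToComplex_chart (s θ : ℝ) (t : MomSpace) :
    momToComplex ![Real.cos θ + s ^ 2 * t 1 * Real.cos θ - s * t 2 * Real.sin θ,
        Real.sin θ + s ^ 2 * t 1 * Real.sin θ + s * t 2 * Real.cos θ] =
      ((Real.cos θ : ℂ) + (Real.sin θ : ℂ) * I) * (((1 + s ^ 2 * t 1 : ℝ) : ℂ) + ((s * t 2 : ℝ) : ℂ) * I) := by
  apply Complex.ext
  · simp only [momToComplex_re, Matrix.cons_val_zero, mul_re, add_re, ofReal_re, mul_im, ofReal_im, I_re, I_im,
      add_im, mul_zero, sub_zero, add_zero, mul_one, zero_add]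
    ring
  · simp only [momToComplex_im, Matrix.cons_val_one, Matrix.cons_val_zero, mul_re, add_re, ofReal_re,
      mul_im, ofReal_im, I_re, I_im, add_im, mul_zero, sub_zero, add_zero, mul_one, zero_add]
    ring

/-- The unit vector `e^{iθ}` is nonzero. [folklore] -/
private theorem cos_add_sin_mul_I_ne_zero (θ : ℝ) : ((Real.cos θ : ℂ) + (Real.sin θ : ℂ) * I) ≠ 0 := by
  intro h
  have h1 := congrArg Complex.re h
  have h2 := congrArg Complex.im h
  simp only [add_re, ofReal_re, mul_re, I_re, mul_zero, ofReal_im, I_im, mul_one, sub_self, add_zero, zero_re,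
    add_im, mul_im, zero_add, zero_im] at h1 h2
  nlinarith [Real.sin_sq_add_cos_sq θ]

/-- The polar angle of the chart point is `θ + arg U` modulo `2π` (`U ≠ 0`). [folklore] -/
private theorem polarAngle_chart {s θ : ℝ} {t : MomSpace}
    (hU : (((1 + s ^ 2 * t 1 : ℝ) : ℂ) + ((s * t 2 : ℝ) : ℂ) * I) ≠ 0) :
    ∃ n : ℤ, polarAngle ![Real.cos θ + s ^ 2 * t 1 * Real.cos θ - s * t 2 * Real.sin θ,
        Real.sin θ + s ^ 2 * t 1 * Real.sin θ + s * t 2 * Real.cos θ] - θ =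
      arg (((1 + s ^ 2 * t 1 : ℝ) : ℂ) + ((s * t 2 : ℝ) : ℂ) * I) + 2 * Real.pi * n := by
  have hangle : ((polarAngle ![Real.cos θ + s ^ 2 * t 1 * Real.cos θ - s * t 2 * Real.sin θ,
        Real.sin θ + s ^ 2 * t 1 * Real.sin θ + s * t 2 * Real.cos θ] : ℝ) : Real.Angle) =
      ((θ + arg (((1 + s ^ 2 * t 1 : ℝ) : ℂ) + ((s * t 2 : ℝ) : ℂ) * I) : ℝ) : Real.Angle) := by
    rw [polarAngle, momToComplex_chart, arg_mul_coe_angle (cos_add_sin_mul_I_ne_zero θ) hU, Real.Angle.coe_add]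
    congr 1
    have h := arg_cos_add_sin_mul_I_coe_angle (θ : Real.Angle)
    rw [Real.Angle.cos_coe, Real.Angle.sin_coe] at h
    exact h
  obtain ⟨n, hn⟩ := Real.Angle.angle_eq_iff_two_pi_dvd_sub.1 hangle
  exact ⟨n, by linarith⟩

/-- In the chart, `e(k⃗) = |k⃗|² − 1 = s²Ẽ`, `Ẽ = 2t₁ + s²t₁² + t₂²` (the curvature of the Fermi circle makes the tangential direction second order). [cite: DisertoriRivasseau2000, App. A (A.5) p0016:L152–155] -/
private theorem dispersion_chart (s θ : ℝ) (t : MomSpace) :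
    dispersion ![Real.cos θ + s ^ 2 * t 1 * Real.cos θ - s * t 2 * Real.sin θ,
      Real.sin θ + s ^ 2 * t 1 * Real.sin θ + s * t 2 * Real.cos θ] = s ^ 2 * (2 * t 1 + s ^ 2 * t 1 ^ 2 + t 2 ^ 2) := by
  rw [dispersion]
  simp only [Matrix.cons_val_zero, Matrix.cons_val_one]
  linear_combination ((1 + s ^ 2 * t 1) ^ 2 + (s * t 2) ^ 2) * Real.sin_sq_add_cos_sq θ

/-- In the chart, `r/Λ² = t₀² + Ẽ²` (`k₀ = s²t₀`, `Λ = s²`). [cite: DisertoriRivasseau2000, §II.2 (II.12) p0004:L10–11] -/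
private theorem rOf_chart {s : ℝ} (hs : s ≠ 0) (θ : ℝ) (t : MomSpace) :
    rOf (s ^ 2 * t 0, ![Real.cos θ + s ^ 2 * t 1 * Real.cos θ - s * t 2 * Real.sin θ,
        Real.sin θ + s ^ 2 * t 1 * Real.sin θ + s * t 2 * Real.cos θ]) / (s ^ 2) ^ 2 =
      t 0 ^ 2 + (2 * t 1 + s ^ 2 * t 1 ^ 2 + t 2 ^ 2) ^ 2 := by
  rw [rOf]
  simp only
  rw [dispersion_chart, div_eq_iff (by positivity)]
  ring

/-- `‖U‖² = 1 + s²Ẽ`. [folklore] -/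
private theorem norm_U_sq (s : ℝ) (t : MomSpace) :
    ‖(((1 + s ^ 2 * t 1 : ℝ) : ℂ) + ((s * t 2 : ℝ) : ℂ) * I)‖ ^ 2 = 1 + s ^ 2 * (2 * t 1 + s ^ 2 * t 1 ^ 2 + t 2 ^ 2) := by
  rw [Complex.sq_norm, Complex.normSq_apply]
  simp only [add_re, ofReal_re, mul_re, I_re, mul_zero, ofReal_im, I_im, mul_one, sub_self, add_zero, add_im,
    mul_im, zero_add]
  ring

/-- **The sector cutoff in the chart**: for `0 < s ≤ 1` and `U ≠ 0`, `χ_θ(θ(k⃗)) = u(arg U / s)` — the periodised cutoff of period `2π/s` evaluated at `(arg U + 2πn)/s` keeps exactly its central translate («F₁ = u_p[α_q^{1/4} f₁]», `f₁ = θ − θ_s`). [cite: DisertoriRivasseau2000, §III.3.1 (III.10)–(III.11) p0009:L57–78, App. A (A.4)–(A.6) p0016:L148–165] -/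
private theorem sectorChiMom_chart {u : ℝ → ℝ} (hu : IsCutoff u) {s : ℝ} (hs : 0 < s) (hs1 : s ≤ 1) (θ : ℝ)
    (t : MomSpace) (hU0 : (((1 + s ^ 2 * t 1 : ℝ) : ℂ) + ((s * t 2 : ℝ) : ℂ) * I) ≠ 0) :
    sectorChiMom u (1 / (s ^ 2) ^ 2) θ
        ![Real.cos θ + s ^ 2 * t 1 * Real.cos θ - s * t 2 * Real.sin θ,
          Real.sin θ + s ^ 2 * t 1 * Real.sin θ + s * t 2 * Real.cos θ] =
      u (s⁻¹ * arg (((1 + s ^ 2 * t 1 : ℝ) : ℂ) + ((s * t 2 : ℝ) : ℂ) * I)) := by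
  set U : ℂ := ((1 + s ^ 2 * t 1 : ℝ) : ℂ) + ((s * t 2 : ℝ) : ℂ) * I with hUdef
  have hπ := Real.pi_gt_three
  obtain ⟨n, hn⟩ := polarAngle_chart (s := s) (θ := θ) (t := t) hU0
  have hw : (1 / (s ^ 2) ^ 2 : ℝ) ^ (1 / 4 : ℝ) = s⁻¹ := by
    rw [show (1 / (s ^ 2) ^ 2 : ℝ) = s⁻¹ ^ 4 by rw [one_div, inv_pow, ← pow_mul],
      show (1 / 4 : ℝ) = ((4 : ℕ) : ℝ)⁻¹ by norm_num]
    exact Real.pow_rpow_inv_natCast (inv_pos.2 hs).le (by norm_num)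
  have hsinv : 1 ≤ s⁻¹ := (one_le_inv₀ hs).2 hs1
  rw [sectorChiMom, sectorChi, hw, hn, show s⁻¹ * (arg U + 2 * Real.pi * n) = s⁻¹ * arg U + n * (2 * Real.pi * s⁻¹) by ring,
    periodise_add_int_mul, periodise_eq_of_abs_le hu]
  · calc (1 : ℝ) < 2 * Real.pi := by linarith
      _ ≤ 2 * Real.pi * s⁻¹ := le_mul_of_one_le_right (by positivity) hsinv
  · rw [abs_mul, abs_of_pos (inv_pos.2 hs), show 2 * Real.pi * s⁻¹ / 2 = s⁻¹ * Real.pi by ring]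
    exact mul_le_mul_of_nonneg_left (Complex.abs_arg_le_pi U) (inv_pos.2 hs).le

/-! ### The normalized symbol `N_σ(t) = u'(t₀² + Ẽ²) (i t₀ + Ẽ) u(arg U / σ)` and the chart identity -/

/-- **The tree-line symbol in the chart**: for `0 < σ ≤ 1` (`Λ(w_q) = σ²`), every sector centre `θ` and every
rescaled point `t`, `C^{w_q}(k) χ_θ(θ(k⃗))` at `k = (σ²t₀, (1 + σ²t₁)e(θ) + σ t₂ τ(θ))` equals `(1 − Λ²)/σ⁶ · N_σ(t)`
(«C^{w_q,θ}(k₀,k_r,k_t) = F₁(k_r,k_t) F₂(k₀,k_r,k_t) F₃(k₀,k_r,k_t)», (II.24), (A.4)–(A.6)).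
[cite: DisertoriRivasseau2000, §II.4.1 (II.24) p0005:L70–76, App. A (A.4)–(A.6) p0016:L136–170] -/
private theorem treeLine_rescaled_eq {u : ℝ → ℝ} (hu : IsCutoff u) {σ : ℝ} (hσ : 0 < σ) (hσ1 : σ ≤ 1) (Λ θ : ℝ)
    (t : MomSpace) :
    treeLineSymbol u Λ 1 (σ ^ 2) (σ ^ 2 * t 0,
          ![Real.cos θ + σ ^ 2 * t 1 * Real.cos θ - σ * t 2 * Real.sin θ,
            Real.sin θ + σ ^ 2 * t 1 * Real.sin θ + σ * t 2 * Real.cos θ]) *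
        (sectorChiMom u (1 / (σ ^ 2) ^ 2) θ
          ![Real.cos θ + σ ^ 2 * t 1 * Real.cos θ - σ * t 2 * Real.sin θ,
            Real.sin θ + σ ^ 2 * t 1 * Real.sin θ + σ * t 2 * Real.cos θ] : ℂ) =
      (((1 - Λ ^ 2) / σ ^ 6 : ℝ) : ℂ) *
        (((deriv u (t 0 ^ 2 + (2 * t 1 + σ ^ 2 * t 1 ^ 2 + t 2 ^ 2) ^ 2) : ℝ) : ℂ) *
          (I * ((t 0 : ℝ) : ℂ) + ((2 * t 1 + σ ^ 2 * t 1 ^ 2 + t 2 ^ 2 : ℝ) : ℂ)) *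
          ((u (σ⁻¹ * arg (((1 + σ ^ 2 * t 1 : ℝ) : ℂ) + ((σ * t 2 : ℝ) : ℂ) * I)) : ℝ) : ℂ)) := by
  set U : ℂ := ((1 + σ ^ 2 * t 1 : ℝ) : ℂ) + ((σ * t 2 : ℝ) : ℂ) * I with hUdef
  set E : ℝ := 2 * t 1 + σ ^ 2 * t 1 ^ 2 + t 2 ^ 2 with hE
  have hσ0 : σ ≠ 0 := hσ.ne'
  have hr : rOf (σ ^ 2 * t 0, ![Real.cos θ + σ ^ 2 * t 1 * Real.cos θ - σ * t 2 * Real.sin θ,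
      Real.sin θ + σ ^ 2 * t 1 * Real.sin θ + σ * t 2 * Real.cos θ]) / (σ ^ 2) ^ 2 = t 0 ^ 2 + E ^ 2 := rOf_chart hσ0 θ t
  rw [treeLineSymbol]
  simp only
  rw [hr, dispersion_chart]
  by_cases hU0 : U = 0
  · -- at `U = 0` the radial cutoff vanishes: `Ẽ = -1/σ²`, `t₀² + Ẽ² ≥ 1`
    have hn := norm_U_sq σ t
    rw [← hUdef, hU0, norm_zero] at hn
    have hE1 : σ ^ 2 * E = -1 := by rw [hE]; linarith
    have hσ2 : σ ^ 2 ≤ 1 := by nlinarith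
    have h4 : (σ ^ 2) ^ 2 ≤ 1 := by nlinarith
    have h5 : (σ ^ 2) ^ 2 * E ^ 2 = 1 := by rw [← mul_pow, hE1]; norm_num
    have hE2 : 1 ≤ E ^ 2 := by nlinarith [mul_le_mul_of_nonneg_right h4 (sq_nonneg E)]
    have hd : deriv u (t 0 ^ 2 + E ^ 2) = 0 :=
      deriv_cutoff_eq_zero hu (by rw [abs_of_nonneg (by positivity)]; nlinarith [sq_nonneg (t 0)])
    rw [← hE, hd]
    simp
  · rw [sectorChiMom_chart hu hσ hσ1 θ t hU0, ← hUdef, ← hE]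
    push_cast
    field_simp

set_option maxHeartbeats 400000 in
/-- **The support of the normalized symbol**: if `N_σ(t) ≠ 0` then `|t₀| ≤ 1`, `|t₁| ≤ 2`, `|t₂| ≤ 1` and
`Re U = 1 + σ²t₁ ≥ 2/5` («k_r ∈ [−α_q^{−1/2}/2, α_q^{−1/2}/2], k_t ∈ [−α_q^{−1/4}/2, α_q^{−1/4}/2]»: the `Λ × Λ × Λ^{1/2}` box
of the sector, `V_f = Λ^{1/2}(w_q)Λ²(w_q)` up to the `k₀` extent). [cite: DisertoriRivasseau2000, App. A Lemma 12 p0017:L3–7, p0017:L22–24] -/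
private theorem good_of_ne_zero {u : ℝ → ℝ} (hu : IsCutoff u) {σ : ℝ} (hσ : 0 < σ) (hσ1 : σ ≤ 1) (t : MomSpace)
    (h : (((deriv u (t 0 ^ 2 + (2 * t 1 + σ ^ 2 * t 1 ^ 2 + t 2 ^ 2) ^ 2) : ℝ) : ℂ) *
          (I * ((t 0 : ℝ) : ℂ) + ((2 * t 1 + σ ^ 2 * t 1 ^ 2 + t 2 ^ 2 : ℝ) : ℂ)) *
          ((u (σ⁻¹ * arg (((1 + σ ^ 2 * t 1 : ℝ) : ℂ) + ((σ * t 2 : ℝ) : ℂ) * I)) : ℝ) : ℂ)) ≠ 0) :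
    |t 0| ≤ 1 ∧ |t 1| ≤ 2 ∧ |t 2| ≤ 1 ∧ 2 / 5 ≤ 1 + σ ^ 2 * t 1 := by
  set U : ℂ := ((1 + σ ^ 2 * t 1 : ℝ) : ℂ) + ((σ * t 2 : ℝ) : ℂ) * I with hUdef
  set E : ℝ := 2 * t 1 + σ ^ 2 * t 1 ^ 2 + t 2 ^ 2 with hE
  obtain ⟨h12, hχ⟩ := mul_ne_zero_iff.1 h
  obtain ⟨hd, _⟩ := mul_ne_zero_iff.1 h12
  -- the radial cutoff: `t₀² + Ẽ² ≤ 1/2`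
  have hsupp : t 0 ^ 2 + E ^ 2 ≤ 1 / 2 := by
    by_contra h'
    exact hd (by rw [deriv_cutoff_eq_zero hu (by rw [abs_of_nonneg (by positivity)]; linarith), Complex.ofReal_zero])
  have hE2 : E ^ 2 < (3 / 4) ^ 2 := by linarith [sq_nonneg (t 0)]
  obtain ⟨hE34, hE34'⟩ := abs_lt_of_sq_lt_sq' hE2 (by norm_num)
  have hs2 : σ ^ 2 ≤ 1 := by nlinarith
  have hss : 0 < σ ^ 2 := by positivity
  have hnormsq : ‖U‖ ^ 2 = 1 + σ ^ 2 * E := norm_U_sq σ t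
  have hsE_lo : σ ^ 2 * (-(3 / 4)) ≤ σ ^ 2 * E := mul_le_mul_of_nonneg_left hE34.le hss.le
  have hsE_hi : σ ^ 2 * E ≤ σ ^ 2 * (3 / 4) := mul_le_mul_of_nonneg_left hE34'.le hss.le
  have hnorm_lo : 1 - 3 / 4 * σ ^ 2 ≤ ‖U‖ ^ 2 := by rw [hnormsq]; linarith
  have hnorm_hi : ‖U‖ ^ 2 ≤ 1 + 3 / 4 * σ ^ 2 := by rw [hnormsq]; linarith
  have hU0 : U ≠ 0 := by
    intro h0; rw [h0, norm_zero] at hnorm_lo; linarith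
  have hUpos : 0 < ‖U‖ := norm_pos_iff.2 hU0
  have hnorm2 : ‖U‖ ≤ 2 := (pow_le_pow_iff_left₀ hUpos.le zero_le_two two_ne_zero).1 (by linarith)
  have hnorm12 : 1 / 2 ≤ ‖U‖ := by nlinarith [norm_nonneg U]
  -- the sector cutoff: `|arg U| ≤ σ/2`
  have harg : |arg U| ≤ σ / 2 := by
    by_contra h'
    refine hχ ?_
    rw [hu.eq_zero _ (by rw [abs_mul, abs_of_pos (inv_pos.2 hσ), ← div_eq_inv_mul, lt_div_iff₀ hσ]; linarith),
      Complex.ofReal_zero]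
  have him : σ * t 2 = ‖U‖ * Real.sin (arg U) := by
    rw [Complex.sin_arg, mul_div_cancel₀ _ hUpos.ne']
    simp only [hUdef, add_im, ofReal_im, mul_im, ofReal_re, I_re, I_im, mul_zero, mul_one, zero_add, add_zero]
  have hre : 1 + σ ^ 2 * t 1 = ‖U‖ * Real.cos (arg U) := by
    rw [Complex.cos_arg hU0, mul_div_cancel₀ _ hUpos.ne']
    simp only [hUdef, add_re, ofReal_re, mul_re, ofReal_im, I_re, I_im, mul_zero, mul_one, add_zero, sub_self]
  have hsin : |Real.sin (arg U)| ≤ σ / 2 := Real.abs_sin_le_abs.trans harg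
  have hcos : 1 - σ ^ 2 / 8 ≤ Real.cos (arg U) := by
    have h1 := Real.one_sub_sq_div_two_le_cos (x := arg U)
    have h2 : (arg U) ^ 2 ≤ (σ / 2) ^ 2 := by
      rw [← sq_abs]; exact pow_le_pow_left₀ (abs_nonneg _) harg 2
    linarith
  refine ⟨?_, ?_, ?_, ?_⟩
  · exact (sq_le_one_iff_abs_le_one _).1 (by linarith [sq_nonneg E])
  · have hup : ‖U‖ ≤ 1 + 2 * σ ^ 2 := by
      refine (pow_le_pow_iff_left₀ hUpos.le (by positivity) two_ne_zero).1 (hnorm_hi.trans ?_)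
      have : (1 + 2 * σ ^ 2) ^ 2 = 1 + 3 / 4 * σ ^ 2 + (13 / 4 * σ ^ 2 + 4 * (σ ^ 2) ^ 2) := by ring
      rw [this]
      linarith [sq_nonneg (σ ^ 2)]
    have hlo : 1 - σ ^ 2 ≤ ‖U‖ := by
      by_cases h1 : 1 ≤ ‖U‖
      · linarith
      · push Not at h1
        have : ‖U‖ ^ 2 ≤ ‖U‖ := by rw [sq]; exact mul_le_of_le_one_right hUpos.le h1.le
        linarith
    have ht1up : σ ^ 2 * t 1 ≤ σ ^ 2 * 2 := by
      have : ‖U‖ * Real.cos (arg U) ≤ ‖U‖ := mul_le_of_le_one_right hUpos.le (Real.cos_le_one _)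
      linarith
    have ht1lo : σ ^ 2 * (-2) ≤ σ ^ 2 * t 1 := by
      have h1 : (1 - σ ^ 2) * (1 - σ ^ 2 / 8) ≤ ‖U‖ * Real.cos (arg U) :=
        mul_le_mul hlo hcos (by linarith) hUpos.le
      have h2 : (1 - σ ^ 2) * (1 - σ ^ 2 / 8) = 1 + σ ^ 2 * (-2) + (7 / 8 * σ ^ 2 + (σ ^ 2) ^ 2 / 8) := by ring
      rw [h2] at h1
      linarith [sq_nonneg (σ ^ 2)]
    exact abs_le.2 ⟨le_of_mul_le_mul_left ht1lo hss, le_of_mul_le_mul_left ht1up hss⟩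
  · have h1 : |σ * t 2| ≤ 2 * (σ / 2) := by
      rw [him, abs_mul, abs_of_pos hUpos]
      exact mul_le_mul hnorm2 hsin (abs_nonneg _) (by norm_num)
    rw [abs_mul, abs_of_pos hσ] at h1
    exact le_of_mul_le_mul_left (by linarith) hσ
  · -- `Re U = ‖U‖ cos(arg U) ≥ (1/2)(7/8)`
    rw [hre]
    have : 1 / 2 * (7 / 8 : ℝ) ≤ ‖U‖ * Real.cos (arg U) := mul_le_mul hnorm12 (by nlinarith) (by norm_num) hUpos.le
    linarith

/-- **The normalized symbol is smooth** (`0 < σ`): near points of its support it is the displayed composition of smooth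
functions (`Re U > 0`), elsewhere it vanishes identically («C₀^{w_q,θ} is a Gevrey function with compact support»).
[cite: DisertoriRivasseau2000, App. A Lemma 12 p0017:L8–12] -/
private theorem contDiff_nsym {u : ℝ → ℝ} (hu : IsCutoff u) {σ : ℝ} (hσ : 0 < σ) (hσ1 : σ ≤ 1) :
    ContDiff ℝ ∞ fun t : MomSpace =>
      ((deriv u (t 0 ^ 2 + (2 * t 1 + σ ^ 2 * t 1 ^ 2 + t 2 ^ 2) ^ 2) : ℝ) : ℂ) *
        (I * ((t 0 : ℝ) : ℂ) + ((2 * t 1 + σ ^ 2 * t 1 ^ 2 + t 2 ^ 2 : ℝ) : ℂ)) *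
        ((u (σ⁻¹ * arg (((1 + σ ^ 2 * t 1 : ℝ) : ℂ) + ((σ * t 2 : ℝ) : ℂ) * I)) : ℝ) : ℂ) := by
  set N : MomSpace → ℂ := fun t : MomSpace =>
      ((deriv u (t 0 ^ 2 + (2 * t 1 + σ ^ 2 * t 1 ^ 2 + t 2 ^ 2) ^ 2) : ℝ) : ℂ) *
        (I * ((t 0 : ℝ) : ℂ) + ((2 * t 1 + σ ^ 2 * t 1 ^ 2 + t 2 ^ 2 : ℝ) : ℂ)) *
        ((u (σ⁻¹ * arg (((1 + σ ^ 2 * t 1 : ℝ) : ℂ) + ((σ * t 2 : ℝ) : ℂ) * I)) : ℝ) : ℂ) with hN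
  have h0 : ContDiff ℝ ∞ fun t : MomSpace => t 0 := (contDiff_momSpace_coord 0).comp (contDiff_const.prodMk contDiff_id :
    ContDiff ℝ ∞ fun t : MomSpace => ((((0 : ℝ), (0 : ℝ)), t) : (ℝ × ℝ) × MomSpace))
  have h1 : ContDiff ℝ ∞ fun t : MomSpace => t 1 := (contDiff_momSpace_coord 1).comp (contDiff_const.prodMk contDiff_id :
    ContDiff ℝ ∞ fun t : MomSpace => ((((0 : ℝ), (0 : ℝ)), t) : (ℝ × ℝ) × MomSpace))
  have h2 : ContDiff ℝ ∞ fun t : MomSpace => t 2 := (contDiff_momSpace_coord 2).comp (contDiff_const.prodMk contDiff_id :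
    ContDiff ℝ ∞ fun t : MomSpace => ((((0 : ℝ), (0 : ℝ)), t) : (ℝ × ℝ) × MomSpace))
  have hE : ContDiff ℝ ∞ fun t : MomSpace => 2 * t 1 + σ ^ 2 * t 1 ^ 2 + t 2 ^ 2 :=
    ((contDiff_const.mul h1).add (contDiff_const.mul (h1.pow 2))).add (h2.pow 2)
  have hU : ContDiff ℝ ∞ fun t : MomSpace => (((1 + σ ^ 2 * t 1 : ℝ) : ℂ) + ((σ * t 2 : ℝ) : ℂ) * I) :=
    (ofRealCLM.contDiff.comp (contDiff_const.add (contDiff_const.mul h1))).add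
      ((ofRealCLM.contDiff.comp (contDiff_const.mul h2)).mul contDiff_const)
  have hF12 : ContDiff ℝ ∞ fun t : MomSpace =>
      ((deriv u (t 0 ^ 2 + (2 * t 1 + σ ^ 2 * t 1 ^ 2 + t 2 ^ 2) ^ 2) : ℝ) : ℂ) *
        (I * ((t 0 : ℝ) : ℂ) + ((2 * t 1 + σ ^ 2 * t 1 ^ 2 + t 2 ^ 2 : ℝ) : ℂ)) :=
    (ofRealCLM.contDiff.comp ((contDiff_deriv_cutoff hu).comp ((h0.pow 2).add (hE.pow 2)))).mul
      ((contDiff_const.mul (ofRealCLM.contDiff.comp h0)).add (ofRealCLM.contDiff.comp hE))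
  refine contDiff_iff_contDiffAt.2 fun t => ?_
  by_cases hre : 0 < 1 + σ ^ 2 * t 1
  · -- `U(t) ∈ slitPlane`: the angular factor is smooth at `t`
    have hre' : ((((1 + σ ^ 2 * t 1 : ℝ) : ℂ) + ((σ * t 2 : ℝ) : ℂ) * I)).re = 1 + σ ^ 2 * t 1 := by
      simp only [add_re, ofReal_re, mul_re, ofReal_im, I_re, I_im, mul_zero, mul_one, add_zero, sub_self]
    have hslit : (((1 + σ ^ 2 * t 1 : ℝ) : ℂ) + ((σ * t 2 : ℝ) : ℂ) * I) ∈ slitPlane := Or.inl (by rw [hre']; exact hre)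
    have harg : ContDiffAt ℝ ∞ (fun t : MomSpace => arg (((1 + σ ^ 2 * t 1 : ℝ) : ℂ) + ((σ * t 2 : ℝ) : ℂ) * I)) t := by
      have hlog : ContDiffAt ℝ ∞ (Complex.log ∘ fun t : MomSpace => (((1 + σ ^ 2 * t 1 : ℝ) : ℂ) + ((σ * t 2 : ℝ) : ℂ) * I)) t :=
        ((Complex.contDiffAt_log (n := ∞) hslit).restrict_scalars ℝ).comp t hU.contDiffAt
      have him := Complex.imCLM.contDiff.contDiffAt.comp t hlog
      refine him.congr_of_eventuallyEq (Eventually.of_forall fun t' => ?_)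
      simp [Function.comp, Complex.log_im]
    exact hF12.contDiffAt.mul (ofRealCLM.contDiff.contDiffAt.comp t (hu.smooth.contDiffAt.comp t (contDiffAt_const.mul harg)))
  · -- `Re U ≤ 0`: the symbol vanishes identically near `t`
    push Not at hre
    have hzero : ∀ t' : MomSpace, 1 + σ ^ 2 * t' 1 < 2 / 5 → N t' = 0 := by
      intro t' ht'
      by_contra hne
      exact absurd (good_of_ne_zero hu hσ hσ1 t' hne).2.2.2 (not_le.2 ht')
    have hopen : IsOpen {t' : MomSpace | 1 + σ ^ 2 * t' 1 < 2 / 5} :=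
      isOpen_lt (continuous_const.add (continuous_const.mul (h1.continuous))) continuous_const
    have hev : N =ᶠ[𝓝 t] fun _ => 0 := by
      filter_upwards [hopen.mem_nhds (show t ∈ {t' : MomSpace | 1 + σ ^ 2 * t' 1 < 2 / 5} by
        simp only [mem_setOf_eq]; linarith)] with t' ht'
      exact hzero t' ht'
    exact (contDiffAt_const (𝕜 := ℝ) (c := (0 : ℂ))).congr_of_eventuallyEq hev

/-- **The support box**: `tsupport N_σ ⊆ {|t₀| ≤ 1, |t₁| ≤ 2, |t₂| ≤ 1, 1 + σ²t₁ ≥ 2/5}` («with compact support»).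
[cite: DisertoriRivasseau2000, App. A Lemma 12 p0017:L3–12] -/
private theorem tsupport_nsym_subset {u : ℝ → ℝ} (hu : IsCutoff u) {σ : ℝ} (hσ : 0 < σ) (hσ1 : σ ≤ 1) :
    tsupport (fun t : MomSpace =>
      ((deriv u (t 0 ^ 2 + (2 * t 1 + σ ^ 2 * t 1 ^ 2 + t 2 ^ 2) ^ 2) : ℝ) : ℂ) *
        (I * ((t 0 : ℝ) : ℂ) + ((2 * t 1 + σ ^ 2 * t 1 ^ 2 + t 2 ^ 2 : ℝ) : ℂ)) *
        ((u (σ⁻¹ * arg (((1 + σ ^ 2 * t 1 : ℝ) : ℂ) + ((σ * t 2 : ℝ) : ℂ) * I)) : ℝ) : ℂ)) ⊆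
      {t : MomSpace | |t 0| ≤ 1 ∧ |t 1| ≤ 2 ∧ |t 2| ≤ 1} ∩ {t : MomSpace | 2 / 5 ≤ 1 + σ ^ 2 * t 1} := by
  have h1c : Continuous fun t : MomSpace => t 1 := (contDiff_momSpace_coord 1 (n := 0)).continuous.comp
    (continuous_const.prodMk continuous_id : Continuous fun t : MomSpace => ((((0 : ℝ), (0 : ℝ)), t) : (ℝ × ℝ) × MomSpace))
  refine closure_minimal (fun v hv => ?_) ((isCompact_momBox _ _ _).isClosed.inter
    (isClosed_le continuous_const (continuous_const.add (continuous_const.mul h1c))))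
  have h := good_of_ne_zero hu hσ hσ1 v (Function.mem_support.1 hv)
  exact ⟨⟨h.1, h.2.1, h.2.2.1⟩, h.2.2.2⟩

/-! ## 4. Gevrey bounds of the normalized symbol along the lines of the chart, uniformly in the scale -/

/-- Smooth functions are `C^k` at every point for every finite `k`. [folklore] -/
private theorem contDiffAt_nat_of_contDiff {F : Type*} [NormedAddCommGroup F] [NormedSpace ℝ F] {f : ℝ → F}
    (hf : ContDiff ℝ ∞ f) (x : ℝ) (k : ℕ) : ContDiffAt ℝ k f x :=
  (hf.of_le (by exact_mod_cast le_top)).contDiffAt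

/-- **The normalized symbol along a line of the chart is Gevrey-`s`, uniformly in `σ ∈ (0,1]`** («it is then easy to
check that C₀^{w_q,θ}(k₀,k_r,k_t) is a Gevrey function with compact support of class s and satisfies the bound
‖∂₀^{n₀}∂_r^{n_r}∂_t^{n_t} C‖_∞ ≤ α_q^{-1/2} C₀^{|n|} α_q^{(n_r+n₀)/2} α_q^{n_t/4} (n₀!n_r!n_t!)^s»; here in the rescaled
variables `t`, along the line `τ ↦ t + τv` with `|t_i| ≤ 2`, `|v_i| ≤ 1`, `Re U(t) ≥ 2/5`): with Gevrey constants
`A₁, C₁` of `u, u'`, `‖∂_τⁿ N_σ(t + τv)|_{τ=0}‖ ≤ 14A₁² · C_*ⁿ · (n!)^s`, `C_* = 12(148C₁ + 2) + 6 + 5(C₁ + 2)` — the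
three factors `F₃ = u'(t₀² + Ẽ²)` (composition with a quartic polynomial), `F₂ = it₀ + Ẽ`, `F₁ = u(arg U/σ)` (composition
with the rescaled angle) and their product. [cite: DisertoriRivasseau2000, App. A Lemma 12 (A.4)–(A.7) p0016:L144–170, p0017:L1–21] -/
private theorem line_bound {u : ℝ → ℝ} (hu : IsCutoff u) {s A₁ C₁ : ℝ} (hs : 1 ≤ s) (hA₁ : 0 < A₁) (hC₁ : 0 < C₁)
    (hub : ∀ (k : ℕ) (y : ℝ), ‖iteratedDeriv k (fun r => ((u r : ℝ) : ℂ)) y‖ ≤ A₁ * C₁ ^ k * ((k ! : ℕ) : ℝ) ^ s)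
    (hu'b : ∀ (k : ℕ) (y : ℝ), ‖iteratedDeriv k (fun r => ((deriv u r : ℝ) : ℂ)) y‖ ≤ A₁ * C₁ ^ k * ((k ! : ℕ) : ℝ) ^ s)
    {σ : ℝ} (hσ : 0 < σ) (hσ1 : σ ≤ 1) {t0 t1 t2 v0 v1 v2 : ℝ} (ht0 : |t0| ≤ 2) (ht1 : |t1| ≤ 2) (ht2 : |t2| ≤ 2)
    (hv0 : |v0| ≤ 1) (hv1 : |v1| ≤ 1) (hv2 : |v2| ≤ 1) (hre : 2 / 5 ≤ 1 + σ ^ 2 * t1) (n : ℕ) :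
    ‖iteratedDeriv n (fun τ : ℝ =>
      ((deriv u ((t0 + τ * v0) ^ 2 + (2 * (t1 + τ * v1) + σ ^ 2 * (t1 + τ * v1) ^ 2 + (t2 + τ * v2) ^ 2) ^ 2) : ℝ) : ℂ) *
      (I * ((t0 + τ * v0 : ℝ) : ℂ) + ((2 * (t1 + τ * v1) + σ ^ 2 * (t1 + τ * v1) ^ 2 + (t2 + τ * v2) ^ 2 : ℝ) : ℂ)) *
      ((u (σ⁻¹ * arg ((((1 + σ ^ 2 * t1 : ℝ) : ℂ) + ((σ * t2 : ℝ) : ℂ) * I) +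
        (τ : ℂ) * (((σ ^ 2 * v1 : ℝ) : ℂ) + ((σ * v2 : ℝ) : ℂ) * I))) : ℝ) : ℂ)) 0‖ ≤
      A₁ * 14 * A₁ * (12 * (C₁ * 148 + 2) + 6 + 5 * (C₁ * 1 + 2)) ^ n * ((n ! : ℕ) : ℝ) ^ s := by
  have hs0 : 0 ≤ s := by linarith
  have hv0' : |v0| ≤ 2 := hv0.trans (by norm_num)
  have hv1' : |v1| ≤ 2 := hv1.trans (by norm_num)
  have hv2' : |v2| ≤ 2 := hv2.trans (by norm_num)
  -- the line `a + τ b` of the point `U`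
  set a : ℂ := ((1 + σ ^ 2 * t1 : ℝ) : ℂ) + ((σ * t2 : ℝ) : ℂ) * I with ha_def
  set b : ℂ := ((σ ^ 2 * v1 : ℝ) : ℂ) + ((σ * v2 : ℝ) : ℂ) * I with hb_def
  have hare : 2 / 5 ≤ a.re := by
    have : a.re = 1 + σ ^ 2 * t1 := by
      simp only [ha_def, add_re, ofReal_re, mul_re, ofReal_im, I_re, I_im, mul_zero, mul_one, add_zero, sub_self]
    rw [this]; exact hre
  have hbn : ‖b‖ ≤ 2 * σ := by
    have hσ2 : σ ^ 2 ≤ σ := by nlinarith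
    calc ‖b‖ ≤ ‖((σ ^ 2 * v1 : ℝ) : ℂ)‖ + ‖((σ * v2 : ℝ) : ℂ) * I‖ := norm_add_le _ _
      _ = σ ^ 2 * |v1| + σ * |v2| := by
          rw [norm_mul, Complex.norm_I, mul_one, Complex.norm_real, Complex.norm_real, Real.norm_eq_abs,
            Real.norm_eq_abs, abs_mul, abs_mul, abs_of_pos hσ, abs_of_pos (by positivity : (0 : ℝ) < σ ^ 2)]
      _ ≤ σ ^ 2 * 1 + σ * 1 := by gcongr
      _ ≤ 2 * σ := by linarith
  -- the affine coordinates along the line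
  have hc0 := gevrey_affine ht0 hv0' hs0
  have hc1 := gevrey_affine ht1 hv1' hs0
  have hc2 := gevrey_affine ht2 hv2' hs0
  have cd0 : ContDiff ℝ ∞ (fun τ : ℝ => t0 + τ * v0) := by fun_prop
  have cd1 : ContDiff ℝ ∞ (fun τ : ℝ => t1 + τ * v1) := by fun_prop
  have cd2 : ContDiff ℝ ∞ (fun τ : ℝ => t2 + τ * v2) := by fun_prop
  -- `Ẽ = 2c₁ + σ²c₁² + c₂²`: bounds `12 · 5ⁿ`
  have hk2 : ∀ i : ℕ, ‖iteratedDeriv i (fun _ : ℝ => (2 : ℝ)) 0‖ ≤ 2 * 0 ^ i * ((i ! : ℕ) : ℝ) ^ s :=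
    gevrey_const (by norm_num) 0
  have hkσ : ∀ i : ℕ, ‖iteratedDeriv i (fun _ : ℝ => σ ^ 2) 0‖ ≤ 1 * 0 ^ i * ((i ! : ℕ) : ℝ) ^ s :=
    gevrey_const (by rw [Real.norm_eq_abs, abs_of_nonneg (by positivity)]; nlinarith) 0
  have h2c1 : ∀ i : ℕ, ‖iteratedDeriv i (fun τ : ℝ => 2 * (t1 + τ * v1)) 0‖ ≤ 2 * 2 * (0 + 1) ^ i * ((i ! : ℕ) : ℝ) ^ s :=
    gevrey_mul isOpen_univ (mem_univ _) contDiffOn_const cd1.contDiffOn hs le_rfl zero_le_one hk2 hc1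
  have hc1sq : ∀ i : ℕ, ‖iteratedDeriv i (fun τ : ℝ => (t1 + τ * v1) ^ 2) 0‖ ≤ 2 * 2 * (1 + 1) ^ i * ((i ! : ℕ) : ℝ) ^ s :=
    gevrey_sq cd1 hs zero_le_one hc1
  have hc2sq : ∀ i : ℕ, ‖iteratedDeriv i (fun τ : ℝ => (t2 + τ * v2) ^ 2) 0‖ ≤ 2 * 2 * (1 + 1) ^ i * ((i ! : ℕ) : ℝ) ^ s :=
    gevrey_sq cd2 hs zero_le_one hc2
  have hc0sq : ∀ i : ℕ, ‖iteratedDeriv i (fun τ : ℝ => (t0 + τ * v0) ^ 2) 0‖ ≤ 2 * 2 * (1 + 1) ^ i * ((i ! : ℕ) : ℝ) ^ s :=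
    gevrey_sq cd0 hs zero_le_one hc0
  have hσc1sq : ∀ i : ℕ, ‖iteratedDeriv i (fun τ : ℝ => σ ^ 2 * (t1 + τ * v1) ^ 2) 0‖ ≤
      1 * (2 * 2) * (0 + (1 + 1)) ^ i * ((i ! : ℕ) : ℝ) ^ s :=
    gevrey_mul isOpen_univ (mem_univ _) contDiffOn_const (cd1.pow 2).contDiffOn hs le_rfl (by norm_num) hkσ hc1sq
  have cdE1 : ContDiff ℝ ∞ (fun τ : ℝ => 2 * (t1 + τ * v1) + σ ^ 2 * (t1 + τ * v1) ^ 2) := by fun_prop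
  have cdE : ContDiff ℝ ∞ (fun τ : ℝ => 2 * (t1 + τ * v1) + σ ^ 2 * (t1 + τ * v1) ^ 2 + (t2 + τ * v2) ^ 2) := by fun_prop
  have hE1 : ∀ i : ℕ, ‖iteratedDeriv i (fun τ : ℝ => 2 * (t1 + τ * v1) + σ ^ 2 * (t1 + τ * v1) ^ 2) 0‖ ≤
      (2 * 2 + 1 * (2 * 2)) * ((0 + 1) + (0 + (1 + 1))) ^ i * ((i ! : ℕ) : ℝ) ^ s :=
    gevrey_add (contDiffAt_nat_of_contDiff (by fun_prop) 0) (contDiffAt_nat_of_contDiff (by fun_prop) 0)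
      (by norm_num) (by norm_num) h2c1 hσc1sq
  have hE' : ∀ i : ℕ, ‖iteratedDeriv i (fun τ : ℝ => 2 * (t1 + τ * v1) + σ ^ 2 * (t1 + τ * v1) ^ 2 + (t2 + τ * v2) ^ 2) 0‖ ≤
      (2 * 2 + 1 * (2 * 2) + 2 * 2) * ((0 + 1) + (0 + (1 + 1)) + (1 + 1)) ^ i * ((i ! : ℕ) : ℝ) ^ s :=
    gevrey_add (contDiffAt_nat_of_contDiff cdE1 0) (contDiffAt_nat_of_contDiff (cd2.pow 2) 0)
      (by norm_num) (by norm_num) hE1 hc2sq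
  have hE : ∀ i : ℕ, ‖iteratedDeriv i (fun τ : ℝ => 2 * (t1 + τ * v1) + σ ^ 2 * (t1 + τ * v1) ^ 2 + (t2 + τ * v2) ^ 2) 0‖ ≤
      12 * 5 ^ i * ((i ! : ℕ) : ℝ) ^ s := gevrey_mono (by norm_num) (by norm_num) (by norm_num) hE'
  -- `P = c₀² + Ẽ²`: bounds `148 · 12ⁿ`
  have hEsq : ∀ i : ℕ, ‖iteratedDeriv i (fun τ : ℝ =>
      (2 * (t1 + τ * v1) + σ ^ 2 * (t1 + τ * v1) ^ 2 + (t2 + τ * v2) ^ 2) ^ 2) 0‖ ≤ 12 * 12 * (5 + 5) ^ i * ((i ! : ℕ) : ℝ) ^ s :=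
    gevrey_sq cdE hs (by norm_num) hE
  have cdP : ContDiff ℝ ∞ (fun τ : ℝ => (t0 + τ * v0) ^ 2 +
      (2 * (t1 + τ * v1) + σ ^ 2 * (t1 + τ * v1) ^ 2 + (t2 + τ * v2) ^ 2) ^ 2) := by fun_prop
  have hP' : ∀ i : ℕ, ‖iteratedDeriv i (fun τ : ℝ => (t0 + τ * v0) ^ 2 +
      (2 * (t1 + τ * v1) + σ ^ 2 * (t1 + τ * v1) ^ 2 + (t2 + τ * v2) ^ 2) ^ 2) 0‖ ≤
      (2 * 2 + 12 * 12) * ((1 + 1) + (5 + 5)) ^ i * ((i ! : ℕ) : ℝ) ^ s :=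
    gevrey_add (contDiffAt_nat_of_contDiff (cd0.pow 2) 0) (contDiffAt_nat_of_contDiff (cdE.pow 2) 0)
      (by norm_num) (by norm_num) hc0sq hEsq
  have hP : ∀ i : ℕ, ‖iteratedDeriv i (fun τ : ℝ => (t0 + τ * v0) ^ 2 +
      (2 * (t1 + τ * v1) + σ ^ 2 * (t1 + τ * v1) ^ 2 + (t2 + τ * v2) ^ 2) ^ 2) 0‖ ≤ 148 * 12 ^ i * ((i ! : ℕ) : ℝ) ^ s :=
    gevrey_mono (by norm_num) (by norm_num) (by norm_num) hP'
  -- `F₃ = u'(P)`: bounds `A₁ (12(148C₁ + 2))ⁿ`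
  have cdg' : ContDiff ℝ ∞ (fun y : ℝ => ((deriv u y : ℝ) : ℂ)) := ofRealCLM.contDiff.comp (contDiff_deriv_cutoff hu)
  have hF3c : ∀ i : ℕ, ‖iteratedDeriv i ((fun y : ℝ => ((deriv u y : ℝ) : ℂ)) ∘ (fun τ : ℝ => (t0 + τ * v0) ^ 2 +
      (2 * (t1 + τ * v1) + σ ^ 2 * (t1 + τ * v1) ^ 2 + (t2 + τ * v2) ^ 2) ^ 2)) 0‖ ≤
      A₁ * (12 * (C₁ * 148 + 2)) ^ i * ((i ! : ℕ) : ℝ) ^ s :=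
    gevrey_comp hs hA₁.le hC₁.le (by norm_num) (by norm_num) (contDiffAt_nat_of_contDiff cdg' _)
      (contDiffAt_nat_of_contDiff cdP 0) (fun k => hu'b k _) (fun i _ => hP i)
  have hF3 : ∀ i : ℕ, ‖iteratedDeriv i (fun τ : ℝ => ((deriv u ((t0 + τ * v0) ^ 2 +
      (2 * (t1 + τ * v1) + σ ^ 2 * (t1 + τ * v1) ^ 2 + (t2 + τ * v2) ^ 2) ^ 2) : ℝ) : ℂ)) 0‖ ≤
      A₁ * (12 * (C₁ * 148 + 2)) ^ i * ((i ! : ℕ) : ℝ) ^ s := hF3c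
  have cdF3 : ContDiff ℝ ∞ (fun τ : ℝ => ((deriv u ((t0 + τ * v0) ^ 2 +
      (2 * (t1 + τ * v1) + σ ^ 2 * (t1 + τ * v1) ^ 2 + (t2 + τ * v2) ^ 2) ^ 2) : ℝ) : ℂ)) := cdg'.comp cdP
  -- `F₂ = i c₀ + Ẽ` (complex): bounds `14 · 6ⁿ`
  have hc0C : ∀ i : ℕ, ‖iteratedDeriv i (fun τ : ℝ => ((t0 + τ * v0 : ℝ) : ℂ)) 0‖ ≤ 2 * 1 ^ i * ((i ! : ℕ) : ℝ) ^ s := by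
    intro i; rw [norm_iteratedDeriv_ofReal (contDiffAt_nat_of_contDiff cd0 0 i)]; exact hc0 i
  have hEC : ∀ i : ℕ, ‖iteratedDeriv i (fun τ : ℝ =>
      ((2 * (t1 + τ * v1) + σ ^ 2 * (t1 + τ * v1) ^ 2 + (t2 + τ * v2) ^ 2 : ℝ) : ℂ)) 0‖ ≤ 12 * 5 ^ i * ((i ! : ℕ) : ℝ) ^ s := by
    intro i; rw [norm_iteratedDeriv_ofReal (contDiffAt_nat_of_contDiff cdE 0 i)]; exact hE i
  have hkI : ∀ i : ℕ, ‖iteratedDeriv i (fun _ : ℝ => I) 0‖ ≤ 1 * 0 ^ i * ((i ! : ℕ) : ℝ) ^ s :=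
    gevrey_const (by rw [Complex.norm_I]) 0
  have cd0C : ContDiff ℝ ∞ (fun τ : ℝ => ((t0 + τ * v0 : ℝ) : ℂ)) := ofRealCLM.contDiff.comp cd0
  have cdEC : ContDiff ℝ ∞ (fun τ : ℝ => ((2 * (t1 + τ * v1) + σ ^ 2 * (t1 + τ * v1) ^ 2 + (t2 + τ * v2) ^ 2 : ℝ) : ℂ)) :=
    ofRealCLM.contDiff.comp cdE
  have hIc0 : ∀ i : ℕ, ‖iteratedDeriv i (fun τ : ℝ => I * ((t0 + τ * v0 : ℝ) : ℂ)) 0‖ ≤ 1 * 2 * (0 + 1) ^ i * ((i ! : ℕ) : ℝ) ^ s :=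
    gevrey_mul isOpen_univ (mem_univ _) contDiffOn_const cd0C.contDiffOn hs le_rfl zero_le_one hkI hc0C
  have cdF2 : ContDiff ℝ ∞ (fun τ : ℝ => I * ((t0 + τ * v0 : ℝ) : ℂ) +
      ((2 * (t1 + τ * v1) + σ ^ 2 * (t1 + τ * v1) ^ 2 + (t2 + τ * v2) ^ 2 : ℝ) : ℂ)) := (contDiff_const.mul cd0C).add cdEC
  have hF2' : ∀ i : ℕ, ‖iteratedDeriv i (fun τ : ℝ => I * ((t0 + τ * v0 : ℝ) : ℂ) +
      ((2 * (t1 + τ * v1) + σ ^ 2 * (t1 + τ * v1) ^ 2 + (t2 + τ * v2) ^ 2 : ℝ) : ℂ)) 0‖ ≤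
      (1 * 2 + 12) * ((0 + 1) + 5) ^ i * ((i ! : ℕ) : ℝ) ^ s :=
    gevrey_add (contDiffAt_nat_of_contDiff (contDiff_const.mul cd0C) 0) (contDiffAt_nat_of_contDiff cdEC 0)
      (by norm_num) (by norm_num) hIc0 hEC
  have hF2 : ∀ i : ℕ, ‖iteratedDeriv i (fun τ : ℝ => I * ((t0 + τ * v0 : ℝ) : ℂ) +
      ((2 * (t1 + τ * v1) + σ ^ 2 * (t1 + τ * v1) ^ 2 + (t2 + τ * v2) ^ 2 : ℝ) : ℂ)) 0‖ ≤ 14 * 6 ^ i * ((i ! : ℕ) : ℝ) ^ s :=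
    gevrey_mono (by norm_num) (by norm_num) (by norm_num) hF2'
  -- `F₁ = u(arg(a + τb)/σ)`: bounds `A₁ (5(C₁ + 2))ⁿ`, smooth on the open set where the line is off the cut
  set U₀ : Set ℝ := {τ : ℝ | a + (τ : ℂ) * b ∈ slitPlane} with hU₀
  have hU₀o : IsOpen U₀ := isOpen_affine_preimage_slitPlane a b
  have h0U₀ : (0 : ℝ) ∈ U₀ := by
    show a + ((0 : ℝ) : ℂ) * b ∈ slitPlane
    rw [Complex.ofReal_zero, zero_mul, add_zero]
    exact Or.inl (by linarith)
  have cdg : ContDiff ℝ ∞ (fun y : ℝ => ((u y : ℝ) : ℂ)) := ofRealCLM.contDiff.comp hu.smooth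
  have cdargOn : ContDiffOn ℝ ∞ (fun τ : ℝ => σ⁻¹ * arg (a + (τ : ℂ) * b)) U₀ :=
    contDiffOn_const.mul (contDiffOn_arg_affine a b)
  have cdargAt : ∀ k : ℕ, ContDiffAt ℝ k (fun τ : ℝ => σ⁻¹ * arg (a + (τ : ℂ) * b)) 0 := fun k =>
    ((cdargOn.of_le (by exact_mod_cast le_top)).contDiffWithinAt h0U₀).contDiffAt (hU₀o.mem_nhds h0U₀)
  have hF1c : ∀ i : ℕ, ‖iteratedDeriv i ((fun y : ℝ => ((u y : ℝ) : ℂ)) ∘ (fun τ : ℝ => σ⁻¹ * arg (a + (τ : ℂ) * b))) 0‖ ≤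
      A₁ * (5 * (C₁ * 1 + 2)) ^ i * ((i ! : ℕ) : ℝ) ^ s :=
    gevrey_comp hs hA₁.le hC₁.le zero_le_one (by norm_num) (contDiffAt_nat_of_contDiff cdg _) cdargAt
      (fun k => hub k _) (gevrey_arg_line hσ hσ1 hs hare hbn)
  have hF1 : ∀ i : ℕ, ‖iteratedDeriv i (fun τ : ℝ => ((u (σ⁻¹ * arg (a + (τ : ℂ) * b)) : ℝ) : ℂ)) 0‖ ≤
      A₁ * (5 * (C₁ * 1 + 2)) ^ i * ((i ! : ℕ) : ℝ) ^ s := hF1c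
  have cdF1On : ContDiffOn ℝ ∞ (fun τ : ℝ => ((u (σ⁻¹ * arg (a + (τ : ℂ) * b)) : ℝ) : ℂ)) U₀ := cdg.comp_contDiffOn cdargOn
  -- the product `F₃ F₂ F₁`
  have hF32 : ∀ i : ℕ, ‖iteratedDeriv i (fun τ : ℝ => ((deriv u ((t0 + τ * v0) ^ 2 +
      (2 * (t1 + τ * v1) + σ ^ 2 * (t1 + τ * v1) ^ 2 + (t2 + τ * v2) ^ 2) ^ 2) : ℝ) : ℂ) *
      (I * ((t0 + τ * v0 : ℝ) : ℂ) + ((2 * (t1 + τ * v1) + σ ^ 2 * (t1 + τ * v1) ^ 2 + (t2 + τ * v2) ^ 2 : ℝ) : ℂ))) 0‖ ≤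
      A₁ * 14 * (12 * (C₁ * 148 + 2) + 6) ^ i * ((i ! : ℕ) : ℝ) ^ s :=
    gevrey_mul isOpen_univ (mem_univ _) cdF3.contDiffOn cdF2.contDiffOn hs (by positivity) (by norm_num) hF3 hF2
  exact gevrey_mul hU₀o h0U₀ (cdF3.mul cdF2).contDiffOn cdF1On hs (by positivity) (by positivity) hF32 hF1 n

/-! ## 5. Directional derivatives on `ℝ³`, integration by parts to all orders, optimisation of the order -/

/-- **Uniform directional Gevrey bounds of the normalized symbol**: for a direction `v` with `|v_i| ≤ 1`,
`‖(∂_v)ⁿ N_σ(t)‖ ≤ 14A₁² C_*ⁿ (n!)^s` for all `t ∈ ℝ³` and all `0 < σ ≤ 1` (on the support: the line bound of §4 through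
the restriction to the line `t + τv`; off the support: zero). [cite: DisertoriRivasseau2000, App. A Lemma 12 (A.7) p0017:L11–21] -/
private theorem dirDeriv_nsym_le {u : ℝ → ℝ} (hu : IsCutoff u) {s A₁ C₁ : ℝ} (hs : 1 ≤ s) (hA₁ : 0 < A₁) (hC₁ : 0 < C₁)
    (hub : ∀ (k : ℕ) (y : ℝ), ‖iteratedDeriv k (fun r => ((u r : ℝ) : ℂ)) y‖ ≤ A₁ * C₁ ^ k * ((k ! : ℕ) : ℝ) ^ s)
    (hu'b : ∀ (k : ℕ) (y : ℝ), ‖iteratedDeriv k (fun r => ((deriv u r : ℝ) : ℂ)) y‖ ≤ A₁ * C₁ ^ k * ((k ! : ℕ) : ℝ) ^ s)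
    {σ : ℝ} (hσ : 0 < σ) (hσ1 : σ ≤ 1) (v : MomSpace) (hv : ∀ i, |v i| ≤ 1) (n : ℕ) (t : MomSpace) :
    ‖(dirDeriv v)^[n] (fun t : MomSpace =>
      ((deriv u (t 0 ^ 2 + (2 * t 1 + σ ^ 2 * t 1 ^ 2 + t 2 ^ 2) ^ 2) : ℝ) : ℂ) *
        (I * ((t 0 : ℝ) : ℂ) + ((2 * t 1 + σ ^ 2 * t 1 ^ 2 + t 2 ^ 2 : ℝ) : ℂ)) *
        ((u (σ⁻¹ * arg (((1 + σ ^ 2 * t 1 : ℝ) : ℂ) + ((σ * t 2 : ℝ) : ℂ) * I)) : ℝ) : ℂ)) t‖ ≤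
      A₁ * 14 * A₁ * (12 * (C₁ * 148 + 2) + 6 + 5 * (C₁ * 1 + 2)) ^ n * ((n ! : ℕ) : ℝ) ^ s := by
  have hN := contDiff_nsym hu hσ hσ1
  rw [iterate_dirDeriv_eq_iteratedFDeriv hN v n t]
  by_cases ht : t ∈ tsupport (fun t : MomSpace =>
      ((deriv u (t 0 ^ 2 + (2 * t 1 + σ ^ 2 * t 1 ^ 2 + t 2 ^ 2) ^ 2) : ℝ) : ℂ) *
        (I * ((t 0 : ℝ) : ℂ) + ((2 * t 1 + σ ^ 2 * t 1 ^ 2 + t 2 ^ 2 : ℝ) : ℂ)) *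
        ((u (σ⁻¹ * arg (((1 + σ ^ 2 * t 1 : ℝ) : ℂ) + ((σ * t 2 : ℝ) : ℂ) * I)) : ℝ) : ℂ))
  · obtain ⟨⟨h0, h1, h2⟩, hre⟩ := tsupport_nsym_subset hu hσ hσ1 ht
    have hl := iteratedDeriv_lineRestriction (n := n) (hN.of_le (by exact_mod_cast le_top)) t v 0
    rw [zero_smul, add_zero] at hl
    rw [← hl]
    have hfun : (fun τ : ℝ => (fun t : MomSpace =>
        ((deriv u (t 0 ^ 2 + (2 * t 1 + σ ^ 2 * t 1 ^ 2 + t 2 ^ 2) ^ 2) : ℝ) : ℂ) *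
        (I * ((t 0 : ℝ) : ℂ) + ((2 * t 1 + σ ^ 2 * t 1 ^ 2 + t 2 ^ 2 : ℝ) : ℂ)) *
        ((u (σ⁻¹ * arg (((1 + σ ^ 2 * t 1 : ℝ) : ℂ) + ((σ * t 2 : ℝ) : ℂ) * I)) : ℝ) : ℂ)) (t + τ • v)) = fun τ : ℝ =>
        ((deriv u ((t 0 + τ * v 0) ^ 2 + (2 * (t 1 + τ * v 1) + σ ^ 2 * (t 1 + τ * v 1) ^ 2 + (t 2 + τ * v 2) ^ 2) ^ 2) : ℝ) : ℂ) *
        (I * ((t 0 + τ * v 0 : ℝ) : ℂ) + ((2 * (t 1 + τ * v 1) + σ ^ 2 * (t 1 + τ * v 1) ^ 2 + (t 2 + τ * v 2) ^ 2 : ℝ) : ℂ)) *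
        ((u (σ⁻¹ * arg ((((1 + σ ^ 2 * t 1 : ℝ) : ℂ) + ((σ * t 2 : ℝ) : ℂ) * I) +
          (τ : ℂ) * (((σ ^ 2 * v 1 : ℝ) : ℂ) + ((σ * v 2 : ℝ) : ℂ) * I))) : ℝ) : ℂ) := by
      funext τ
      have hU : (((1 + σ ^ 2 * (t 1 + τ * v 1) : ℝ) : ℂ) + ((σ * (t 2 + τ * v 2) : ℝ) : ℂ) * I) =
          (((1 + σ ^ 2 * t 1 : ℝ) : ℂ) + ((σ * t 2 : ℝ) : ℂ) * I) + (τ : ℂ) * (((σ ^ 2 * v 1 : ℝ) : ℂ) + ((σ * v 2 : ℝ) : ℂ) * I) := by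
        push_cast; ring
      simp only [PiLp.add_apply, PiLp.smul_apply, smul_eq_mul]
      rw [hU]
    rw [hfun]
    exact line_bound hu hs hA₁ hC₁ hub hu'b hσ hσ1 (h0.trans (by norm_num)) h1 (h2.trans (by norm_num)) (hv 0) (hv 1)
      (hv 2) hre n
  · have h0 : iteratedFDeriv ℝ n (fun t : MomSpace =>
        ((deriv u (t 0 ^ 2 + (2 * t 1 + σ ^ 2 * t 1 ^ 2 + t 2 ^ 2) ^ 2) : ℝ) : ℂ) *
        (I * ((t 0 : ℝ) : ℂ) + ((2 * t 1 + σ ^ 2 * t 1 ^ 2 + t 2 ^ 2 : ℝ) : ℂ)) *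
        ((u (σ⁻¹ * arg (((1 + σ ^ 2 * t 1 : ℝ) : ℂ) + ((σ * t 2 : ℝ) : ℂ) * I)) : ℝ) : ℂ)) t = 0 := by
      by_contra hne
      exact ht (support_iteratedFDeriv_subset n (Function.mem_support.2 hne))
    have hz : ‖(0 : MomSpace [×n]→L[ℝ] ℂ) (fun _ => v)‖ = 0 := by simp
    rw [h0, hz]
    positivity

/-- **Optimisation of the order** (the step of Lemma 11, p0016:L127–132): with `n = ⌊(y/C)^{1/s}/2⌋`,
`(C/y)ⁿ (n!)^s ≤ 2^s e^{−a y^{1/s}}`, `a = s log 2/(2C^{1/s})` (`n! ≤ nⁿ` in place of Stirling).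
[cite: DisertoriRivasseau2000, App. A Lemma 11 p0016:L127–132] -/
private theorem gevrey_opt {s C y : ℝ} (hs : 1 ≤ s) (hC : 0 < C) (hy : 0 < y) :
    ∃ n : ℕ, (C / y) ^ n * ((Nat.factorial n : ℕ) : ℝ) ^ s ≤
      (2 : ℝ) ^ s * Real.exp (-(s * Real.log 2 / (2 * C ^ (1 / s))) * y ^ (1 / s)) := by
  have hs0 : 0 < s := by linarith
  set w : ℝ := (y / C) ^ (1 / s) / 2 with hw
  have hw0 : 0 ≤ w := by positivity
  refine ⟨⌊w⌋₊, ?_⟩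
  set n : ℕ := ⌊w⌋₊ with hn
  have hnw : (n : ℝ) ≤ w := Nat.floor_le hw0
  have hwn : w < n + 1 := Nat.lt_floor_add_one w
  have hws : w ^ s = y / C / 2 ^ s := by
    rw [hw, Real.div_rpow (by positivity) (by norm_num), ← Real.rpow_mul (by positivity),
      one_div_mul_cancel hs0.ne', Real.rpow_one]
  have hfact : ((Nat.factorial n : ℕ) : ℝ) ^ s ≤ (y / C / 2 ^ s) ^ n := by
    have h1 : ((Nat.factorial n : ℕ) : ℝ) ≤ (n : ℝ) ^ n := by exact_mod_cast Nat.factorial_le_pow n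
    calc ((Nat.factorial n : ℕ) : ℝ) ^ s ≤ ((n : ℝ) ^ n) ^ s := Real.rpow_le_rpow (by positivity) h1 hs0.le
      _ = ((n : ℝ) ^ s) ^ n := by
          rw [← Real.rpow_natCast, ← Real.rpow_mul (Nat.cast_nonneg _), mul_comm,
            Real.rpow_mul (Nat.cast_nonneg _), Real.rpow_natCast]
      _ ≤ (w ^ s) ^ n := pow_le_pow_left₀ (by positivity) (Real.rpow_le_rpow (Nat.cast_nonneg _) hnw hs0.le) n
      _ = (y / C / 2 ^ s) ^ n := by rw [hws]
  have hprod : (C / y) ^ n * ((Nat.factorial n : ℕ) : ℝ) ^ s ≤ ((2 : ℝ) ^ s)⁻¹ ^ n := by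
    calc (C / y) ^ n * ((Nat.factorial n : ℕ) : ℝ) ^ s ≤ (C / y) ^ n * (y / C / 2 ^ s) ^ n :=
          mul_le_mul_of_nonneg_left hfact (by positivity)
      _ = ((2 : ℝ) ^ s)⁻¹ ^ n := by
          rw [← mul_pow]
          congr 1
          field_simp
  refine hprod.trans ?_
  have hlog : 0 < Real.log 2 := Real.log_pos (by norm_num)
  have hexp : ((2 : ℝ) ^ s)⁻¹ ^ n = Real.exp (-(n * (s * Real.log 2))) := by
    rw [Real.rpow_def_of_pos (by norm_num : (0 : ℝ) < 2), ← Real.exp_neg, ← Real.exp_nat_mul]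
    congr 1
    ring
  have hkey : s * Real.log 2 / (2 * C ^ (1 / s)) * y ^ (1 / s) = s * Real.log 2 * w := by
    rw [hw, Real.div_rpow hy.le hC.le]
    have : 0 < C ^ (1 / s) := by positivity
    field_simp
  rw [hexp, Real.rpow_def_of_pos (by norm_num : (0 : ℝ) < 2), ← Real.exp_add, neg_mul, hkey]
  apply Real.exp_le_exp.2
  nlinarith [mul_pos (sub_pos.2 hwn) (mul_pos hs0 hlog)]

/-- **The Fourier transform of the normalized symbol decays Gevrey-like, uniformly in the scale**: there are `K₁, a > 0`
(depending on the cutoff only) with `‖𝓕N_σ(y)‖ ≤ K₁ e^{−a Σ_j (2π|y_j|)^{1/s}}` for all `0 < σ ≤ 1` and `y ∈ ℝ³`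
(integration by parts to all orders in each coordinate direction, optimisation of the order, geometric mean of the
three directional decays). [cite: DisertoriRivasseau2000, App. A Lemma 11–12 p0016:L116–132, p0017:L18–26] -/
private theorem fourier_nsym_decay {u : ℝ → ℝ} (hu : IsCutoff u) {s A μ : ℝ} (hs : 1 ≤ s) (hG : IsGevreyL1 s A μ u) :
    ∃ K₁ a : ℝ, 0 < K₁ ∧ 0 < a ∧ ∀ σ : ℝ, 0 < σ → σ ≤ 1 → ∀ y : MomSpace,
      ‖𝓕 (fun t : MomSpace =>
        ((deriv u (t 0 ^ 2 + (2 * t 1 + σ ^ 2 * t 1 ^ 2 + t 2 ^ 2) ^ 2) : ℝ) : ℂ) *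
        (I * ((t 0 : ℝ) : ℂ) + ((2 * t 1 + σ ^ 2 * t 1 ^ 2 + t 2 ^ 2 : ℝ) : ℂ)) *
        ((u (σ⁻¹ * arg (((1 + σ ^ 2 * t 1 : ℝ) : ℂ) + ((σ * t 2 : ℝ) : ℂ) * I)) : ℝ) : ℂ)) y‖ ≤
        K₁ * Real.exp (-a * ((2 * Real.pi * |y 0|) ^ (1 / s) + (2 * Real.pi * |y 1|) ^ (1 / s) +
          (2 * Real.pi * |y 2|) ^ (1 / s))) := by
  obtain ⟨A₁, C₁, hA₁, hC₁, hub, hu'b⟩ := exists_gevrey_sup_cutoff hu hs hG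
  have hs0 : 0 < s := by linarith
  set Ast : ℝ := A₁ * 14 * A₁ with hAst
  set Cst : ℝ := 12 * (C₁ * 148 + 2) + 6 + 5 * (C₁ * 1 + 2) with hCst
  have hAst0 : 0 < Ast := by positivity
  have hCst0 : 0 < Cst := by positivity
  set T : Set MomSpace := {t : MomSpace | |t 0| ≤ 1 ∧ |t 1| ≤ 2 ∧ |t 2| ≤ 1} with hT
  have hTc : IsCompact T := isCompact_momBox _ _ _
  set vol : ℝ := (volume T).toReal with hvol_def
  have hvol0 : 0 ≤ vol := ENNReal.toReal_nonneg
  set a₀ : ℝ := s * Real.log 2 / (2 * Cst ^ (1 / s)) with ha₀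
  have ha₀0 : 0 < a₀ := by positivity
  have h2s : (1 : ℝ) ≤ 2 ^ s := Real.one_le_rpow (by norm_num) hs0.le
  refine ⟨Ast * vol * 2 ^ s + 1, a₀ / 3, by positivity, by positivity, fun σ hσ hσ1 y => ?_⟩
  set N : MomSpace → ℂ := fun t : MomSpace =>
        ((deriv u (t 0 ^ 2 + (2 * t 1 + σ ^ 2 * t 1 ^ 2 + t 2 ^ 2) ^ 2) : ℝ) : ℂ) *
        (I * ((t 0 : ℝ) : ℂ) + ((2 * t 1 + σ ^ 2 * t 1 ^ 2 + t 2 ^ 2 : ℝ) : ℂ)) *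
        ((u (σ⁻¹ * arg (((1 + σ ^ 2 * t 1 : ℝ) : ℂ) + ((σ * t 2 : ℝ) : ℂ) * I)) : ℝ) : ℂ) with hNdef
  have hN : ContDiff ℝ ∞ N := contDiff_nsym hu hσ hσ1
  have hsub : tsupport N ⊆ T := fun t ht => (tsupport_nsym_subset hu hσ hσ1 ht).1
  have hsupp : HasCompactSupport N := hTc.of_isClosed_subset (isClosed_tsupport _) hsub
  have hvol : (volume (tsupport N)).toReal ≤ vol := ENNReal.toReal_mono hTc.measure_lt_top.ne (measure_mono hsub)
  -- the decay in each coordinate direction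
  have hdir : ∀ j : Fin 3, ‖𝓕 N y‖ ≤ Ast * vol * 2 ^ s * Real.exp (-a₀ * (2 * Real.pi * |y j|) ^ (1 / s)) := by
    intro j
    have hv : ∀ i : Fin 3, |(EuclideanSpace.single j (1 : ℝ) : MomSpace) i| ≤ 1 := by
      intro i
      rw [PiLp.single_apply]
      split_ifs <;> simp
    have hM : ∀ (n : ℕ) (x : MomSpace), ‖(dirDeriv (EuclideanSpace.single j (1 : ℝ) : MomSpace))^[n] N x‖ ≤
        Ast * Cst ^ n * ((n ! : ℕ) : ℝ) ^ s :=
      fun n x => dirDeriv_nsym_le hu hs hA₁ hC₁ hub hu'b hσ hσ1 _ hv n x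
    have hinner : ⟪(EuclideanSpace.single j (1 : ℝ) : MomSpace), y⟫_ℝ = y j := by
      rw [EuclideanSpace.inner_single_left]; simp
    have hbound : ∀ n : ℕ, |y j| ^ n * ‖𝓕 N y‖ ≤ (2 * Real.pi)⁻¹ ^ n * (Ast * Cst ^ n * ((n ! : ℕ) : ℝ) ^ s * vol) := by
      intro n
      have h := pow_inner_mul_norm_fourier_le_of_bound hN hsupp (EuclideanSpace.single j (1 : ℝ)) y n (hM n) hvol
      rwa [hinner] at h
    have h0 : ‖𝓕 N y‖ ≤ Ast * vol := by
      have := hbound 0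
      simpa using this
    by_cases hy : y j = 0
    · rw [hy, abs_zero, mul_zero, Real.zero_rpow (by positivity), mul_zero, Real.exp_zero, mul_one]
      exact h0.trans (le_mul_of_one_le_right (by positivity) h2s)
    · have hyj : 0 < |y j| := abs_pos.2 hy
      have hY : 0 < 2 * Real.pi * |y j| := by positivity
      obtain ⟨n, hn⟩ := gevrey_opt hs hCst0 hY
      have hpos : 0 < |y j| ^ n := pow_pos hyj n
      have h1 : ‖𝓕 N y‖ ≤ Ast * vol * ((Cst / (2 * Real.pi * |y j|)) ^ n * ((n ! : ℕ) : ℝ) ^ s) := by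
        calc ‖𝓕 N y‖ ≤ (2 * Real.pi)⁻¹ ^ n * (Ast * Cst ^ n * ((n ! : ℕ) : ℝ) ^ s * vol) / |y j| ^ n :=
              (le_div_iff₀' hpos).2 (hbound n)
          _ = Ast * vol * ((Cst / (2 * Real.pi * |y j|)) ^ n * ((n ! : ℕ) : ℝ) ^ s) := by
              rw [div_pow, mul_pow, inv_pow]
              field_simp
      calc ‖𝓕 N y‖ ≤ Ast * vol * ((Cst / (2 * Real.pi * |y j|)) ^ n * ((n ! : ℕ) : ℝ) ^ s) := h1
        _ ≤ Ast * vol * ((2 : ℝ) ^ s * Real.exp (-(s * Real.log 2 / (2 * Cst ^ (1 / s))) * (2 * Real.pi * |y j|) ^ (1 / s))) := by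
            gcongr
        _ = Ast * vol * 2 ^ s * Real.exp (-a₀ * (2 * Real.pi * |y j|) ^ (1 / s)) := by rw [ha₀]; ring
  -- the geometric mean of the three directional bounds
  have hα0 : 0 ≤ (2 * Real.pi * |y 0|) ^ (1 / s) := by positivity
  have hα1 : 0 ≤ (2 * Real.pi * |y 1|) ^ (1 / s) := by positivity
  have hα2 : 0 ≤ (2 * Real.pi * |y 2|) ^ (1 / s) := by positivity
  have key : ∃ j : Fin 3, ((2 * Real.pi * |y 0|) ^ (1 / s) + (2 * Real.pi * |y 1|) ^ (1 / s) +
      (2 * Real.pi * |y 2|) ^ (1 / s)) / 3 ≤ (2 * Real.pi * |y j|) ^ (1 / s) := by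
    by_contra h
    push Not at h
    have h0 := h 0
    have h1 := h 1
    have h2 := h 2
    linarith
  obtain ⟨j, hj⟩ := key
  calc ‖𝓕 N y‖ ≤ Ast * vol * 2 ^ s * Real.exp (-a₀ * (2 * Real.pi * |y j|) ^ (1 / s)) := hdir j
    _ ≤ Ast * vol * 2 ^ s * Real.exp (-(a₀ / 3) * ((2 * Real.pi * |y 0|) ^ (1 / s) + (2 * Real.pi * |y 1|) ^ (1 / s) +
          (2 * Real.pi * |y 2|) ^ (1 / s))) := by
        refine mul_le_mul_of_nonneg_left (Real.exp_le_exp.2 ?_) (by positivity)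
        have hmul := mul_le_mul_of_nonneg_left hj ha₀0.le
        linarith
    _ ≤ (Ast * vol * 2 ^ s + 1) * Real.exp (-(a₀ / 3) * ((2 * Real.pi * |y 0|) ^ (1 / s) + (2 * Real.pi * |y 1|) ^ (1 / s) +
          (2 * Real.pi * |y 2|) ^ (1 / s))) := by
        gcongr; linarith

/-! ## 6. The change of variables back to `δx` and the proof of Lemma 12 -/

/-- **The `T = 0` kernel is a Fourier transform**: `C₀[a](x) = (2π)^{-3} 𝓕(a ∘ split)(ξ)` at the dual point
`ξ = (x₀, −x⃗)/(2π)`. [cite: DisertoriRivasseau2000, §II.1 (II.5)–(II.6) p0003:L64–95] -/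
private theorem zeroKernel_eq_fourier (a : Mom → ℂ) (x : Mom) :
    zeroKernel a x = ((1 / (2 * Real.pi) ^ 3 : ℝ) : ℂ) * 𝓕 (fun q : MomSpace => a (splitMomentum q)) (dualPoint x.1 x.2) := by
  rw [zeroKernel, Real.fourier_eq', ← measurePreserving_splitMomentum.integral_comp splitMomentum.measurableEmbedding]
  congr 1
  refine integral_congr_ae (ae_of_all _ fun q => ?_)
  simp only [splitMomentum_apply, smul_eq_mul, pairing, Matrix.cons_val_zero, Matrix.cons_val_one]
  congr 2
  rw [inner_E3]
  simp only [dualPoint, PiLp.toLp_apply, Matrix.cons_val_zero, Matrix.cons_val_one, Matrix.cons_val_two,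
    Matrix.tail_cons, Matrix.head_cons]
  push_cast
  field_simp
  ring

/-- **The anisotropic chart of the sector** `t ↦ (σ²t₀, σ²t₁ e(θ) + σ t₂ τ(θ))` as a continuous linear automorphism of
`ℝ³`: determinant `σ²·σ²·σ`, adjoint `w ↦ (σ²w₀, σ²⟨e, w⃗⟩, σ⟨τ, w⃗⟩)` (the dual scales).
[cite: DisertoriRivasseau2000, App. A (A.4)–(A.7) p0016:L144–170] -/
private theorem exists_chart {s : ℝ} (hs : 0 < s) (θ : ℝ) :
    ∃ A : MomSpace ≃L[ℝ] MomSpace,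
      (∀ t : MomSpace, A t = WithLp.toLp 2 ![s ^ 2 * t 0,
        s ^ 2 * Real.cos θ * t 1 + -(s * Real.sin θ) * t 2, s ^ 2 * Real.sin θ * t 1 + s * Real.cos θ * t 2]) ∧
      LinearMap.det ((A.symm : MomSpace ≃ₗ[ℝ] MomSpace) : MomSpace →ₗ[ℝ] MomSpace) = (s ^ 2 * s ^ 2 * s)⁻¹ ∧
      ∀ w : MomSpace, ContinuousLinearMap.adjoint (A : MomSpace →L[ℝ] MomSpace) w =
        WithLp.toLp 2 ![s ^ 2 * w 0, s ^ 2 * (Real.cos θ * w 1 + Real.sin θ * w 2),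
          s * (-Real.sin θ * w 1 + Real.cos θ * w 2)] := by
  set Mx : Matrix (Fin 3) (Fin 3) ℝ :=
    !![s ^ 2, 0, 0; 0, s ^ 2 * Real.cos θ, -(s * Real.sin θ); 0, s ^ 2 * Real.sin θ, s * Real.cos θ] with hMx
  have hdetM : Mx.det = s ^ 2 * s ^ 2 * s := by
    rw [hMx, Matrix.det_fin_three]
    simp only [Matrix.of_apply, Matrix.cons_val', Matrix.cons_val_zero, Matrix.cons_val_one, Matrix.cons_val_two,
      Matrix.empty_val', Matrix.cons_val_fin_one, Matrix.head_cons, Matrix.tail_cons, Matrix.head_fin_const]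
    linear_combination (s ^ 2 * s ^ 2 * s) * Real.sin_sq_add_cos_sq θ
  set L : MomSpace →ₗ[ℝ] MomSpace := Matrix.toEuclideanLin Mx with hL
  have hdetL : LinearMap.det L = s ^ 2 * s ^ 2 * s := by
    rw [hL, Matrix.toEuclideanLin, ← hdetM]
    exact LinearMap.det_toLpLin 2 _
  have hdet0 : LinearMap.det L ≠ 0 := by rw [hdetL]; positivity
  set A : MomSpace ≃L[ℝ] MomSpace := (LinearMap.equivOfDetNeZero L hdet0).toContinuousLinearEquiv with hA
  have hAapp : ∀ t : MomSpace, A t = WithLp.toLp 2 ![s ^ 2 * t 0,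
      s ^ 2 * Real.cos θ * t 1 + -(s * Real.sin θ) * t 2, s ^ 2 * Real.sin θ * t 1 + s * Real.cos θ * t 2] := by
    intro t
    change L t = _
    rw [hL, Matrix.toEuclideanLin, Matrix.toLpLin_apply]
    congr 1
    funext i
    fin_cases i <;> simp [hMx, Matrix.mulVec, dotProduct, Fin.sum_univ_three]
  have hdetA : LinearMap.det ((A : MomSpace ≃ₗ[ℝ] MomSpace) : MomSpace →ₗ[ℝ] MomSpace) = s ^ 2 * s ^ 2 * s := by
    rw [← hdetL]; rfl
  refine ⟨A, hAapp, ?_, fun w => ?_⟩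
  · rw [← hdetA]; exact LinearEquiv.det_coe_symm _
  · refine ext_inner_right ℝ fun t => ?_
    rw [ContinuousLinearMap.adjoint_inner_left, ContinuousLinearEquiv.coe_coe, hAapp, inner_E3, inner_E3]
    simp only [Matrix.cons_val_zero, Matrix.cons_val_one, Matrix.cons_val_two, Matrix.tail_cons, Matrix.head_cons]
    ring

/-- In the chart, a symbol on `ℝ × ℝ²` factors through the rescaled symbol: `a ∘ split = (R ∘ A⁻¹) ∘ (· − q_F)` with the
base point `q_F = (0, e(θ))` and `R(t) = a(σ²t₀, (1 + σ²t₁)e(θ) + σ t₂ τ(θ))`. [folklore] -/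
private theorem symbol_comp_split_eq (a : Mom → ℂ) {s : ℝ} (θ : ℝ) {A : MomSpace ≃L[ℝ] MomSpace}
    (hA : ∀ t : MomSpace, A t = WithLp.toLp 2 ![s ^ 2 * t 0,
        s ^ 2 * Real.cos θ * t 1 + -(s * Real.sin θ) * t 2, s ^ 2 * Real.sin θ * t 1 + s * Real.cos θ * t 2]) :
    (fun q : MomSpace => a (splitMomentum q)) =
      ((fun t : MomSpace => a (s ^ 2 * t 0,
          ![Real.cos θ + s ^ 2 * t 1 * Real.cos θ - s * t 2 * Real.sin θ,
            Real.sin θ + s ^ 2 * t 1 * Real.sin θ + s * t 2 * Real.cos θ])) ∘ A.symm) ∘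
        fun q => q + -(WithLp.toLp 2 ![0, Real.cos θ, Real.sin θ] : MomSpace) := by
  have hR : ∀ t : MomSpace, a (s ^ 2 * t 0,
      ![Real.cos θ + s ^ 2 * t 1 * Real.cos θ - s * t 2 * Real.sin θ,
        Real.sin θ + s ^ 2 * t 1 * Real.sin θ + s * t 2 * Real.cos θ]) =
      a (splitMomentum ((WithLp.toLp 2 ![0, Real.cos θ, Real.sin θ] : MomSpace) + A t)) := by
    intro t
    rw [hA, splitMomentum_apply]
    congr 1
    refine Prod.ext ?_ ?_
    · simp
    · ext i
      fin_cases i <;> simp <;> ring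
  funext q
  simp only [Function.comp_apply]
  rw [hR, ContinuousLinearEquiv.apply_symm_apply]
  congr 2
  abel

/-- The Fourier transform of a constant multiple. [folklore] -/
private theorem fourier_const_mul (c : ℂ) (f : MomSpace → ℂ) (w : MomSpace) :
    𝓕 (fun t => c * f t) w = c * 𝓕 f w := by
  rw [Real.fourier_eq, Real.fourier_eq, ← integral_const_mul]
  congr 1
  funext v
  rw [Circle.smul_def, Circle.smul_def, smul_eq_mul, smul_eq_mul]
  ring

/-- **The `T = 0` kernel through the chart**: `|C₀[a](x)| = (2π)^{-3} · σ²σ²σ · |𝓕R(A†ξ)|` with the rescaled symbol `R`,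
the Jacobian `Λ·Λ·Λ^{1/2}` and the dual scales `A†ξ = (σ²x₀, −σ²x_r, −σ x_t)/(2π)`.
[cite: DisertoriRivasseau2000, App. A Lemma 12 p0017:L22–26] -/
private theorem norm_zeroKernel_eq (a : Mom → ℂ) {s : ℝ} (hs : 0 < s) (θ : ℝ) (x : Mom) :
    ‖zeroKernel a x‖ = 1 / (2 * Real.pi) ^ 3 * (s ^ 2 * s ^ 2 * s) *
      ‖𝓕 (fun t : MomSpace => a (s ^ 2 * t 0,
          ![Real.cos θ + s ^ 2 * t 1 * Real.cos θ - s * t 2 * Real.sin θ,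
            Real.sin θ + s ^ 2 * t 1 * Real.sin θ + s * t 2 * Real.cos θ]))
        (WithLp.toLp 2 ![s ^ 2 * dualPoint x.1 x.2 0,
          s ^ 2 * (Real.cos θ * dualPoint x.1 x.2 1 + Real.sin θ * dualPoint x.1 x.2 2),
          s * (-Real.sin θ * dualPoint x.1 x.2 1 + Real.cos θ * dualPoint x.1 x.2 2)] : MomSpace)‖ := by
  obtain ⟨A, hA, hdet, hadj⟩ := exists_chart hs θ
  rw [zeroKernel_eq_fourier, symbol_comp_split_eq a θ hA, norm_mul, norm_fourier_comp_add_right, Complex.norm_real,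
    Real.norm_eq_abs, abs_of_pos (by positivity), fourier_comp_continuousLinearEquiv A.symm, norm_smul,
    ContinuousLinearEquiv.symm_symm, hadj, hdet, inv_inv, Real.norm_eq_abs, abs_abs, abs_of_pos (by positivity)]
  ring

/-- **Lemma 12 of Disertori–Rivasseau 2000, Part I (Appendix A) — PROVED** (discharge of the named fact
`Lemma12TreeLineDecay`, cell F-052): for a cutoff `u` of (II.13) in the Gevrey class (II.14) of order `s > 1` there are
`K, a > 0` with `|C₀^{w_q}(δx, θ)| ≤ K (1 − Λ²)/Λ⁴(w_q) · Λ^{1/2}(w_q)Λ³(w_q) · e^{−a[|δx₀Λ(w_q)|^{1/s} + |δx_rΛ(w_q)|^{1/s} +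
|δx_tΛ^{1/2}(w_q)|^{1/s}]}` for all `0 ≤ Λ < Λ(w_q) ≤ 1`, all sector centres and all `δx` — the Gevrey class of the
sectorised symbol in the anisotropic sector coordinates (§§1–4) turned into stretched-exponential decay on the dual
scales by integration by parts to all orders and optimisation of the order (§5, the step of Lemma 11), through the
sector change of variables (§6). [cite: DisertoriRivasseau2000, App. A Lemma 12 (A.1), (A.4)–(A.7) p0016:L88–97, p0016:L134–170, p0017:L1–26] -/
theorem Lemma12TreeLineDecay_holds : Lemma12TreeLineDecay := by
  intro u s A μ hu hs hG
  have hs1 : 1 ≤ s := hs.le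
  have hπ := Real.pi_pos
  obtain ⟨K₁, a, hK₁, ha, hdec⟩ := fourier_nsym_decay hu hs1 hG
  refine ⟨K₁ / (2 * Real.pi) ^ 3, a, by positivity, ha, fun Λ Λw θs hΛ hΛw hΛw1 x => ?_⟩
  have hΛwpos : 0 < Λw := lt_of_le_of_lt hΛ hΛw
  set σ : ℝ := Real.sqrt Λw with hσ_def
  have hσ : 0 < σ := Real.sqrt_pos.2 hΛwpos
  have hσΛ : σ ^ 2 = Λw := Real.sq_sqrt hΛwpos.le
  have hσ1 : σ ≤ 1 := by rw [hσ_def, ← Real.sqrt_one]; exact Real.sqrt_le_sqrt hΛw1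
  have h1Λ : 0 ≤ 1 - Λ ^ 2 := by nlinarith
  have hhalf : (σ ^ 2) ^ (1 / 2 : ℝ) = σ := by rw [← Real.sqrt_eq_rpow, Real.sqrt_sq hσ.le]
  rw [← hσΛ, hhalf]
  unfold treeLineKernel0
  rw [norm_zeroKernel_eq _ hσ θs x]
  -- the rescaled symbol is `(1 − Λ²)σ^{-6} · N_σ`
  have hR : (fun t : MomSpace => treeLineSymbol u Λ 1 (σ ^ 2) (σ ^ 2 * t 0,
          ![Real.cos θs + σ ^ 2 * t 1 * Real.cos θs - σ * t 2 * Real.sin θs,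
            Real.sin θs + σ ^ 2 * t 1 * Real.sin θs + σ * t 2 * Real.cos θs]) *
        (sectorChiMom u (1 / (σ ^ 2) ^ 2) θs
          ![Real.cos θs + σ ^ 2 * t 1 * Real.cos θs - σ * t 2 * Real.sin θs,
            Real.sin θs + σ ^ 2 * t 1 * Real.sin θs + σ * t 2 * Real.cos θs] : ℂ)) =
      fun t : MomSpace => (((1 - Λ ^ 2) / σ ^ 6 : ℝ) : ℂ) *
        (((deriv u (t 0 ^ 2 + (2 * t 1 + σ ^ 2 * t 1 ^ 2 + t 2 ^ 2) ^ 2) : ℝ) : ℂ) *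
          (I * ((t 0 : ℝ) : ℂ) + ((2 * t 1 + σ ^ 2 * t 1 ^ 2 + t 2 ^ 2 : ℝ) : ℂ)) *
          ((u (σ⁻¹ * arg (((1 + σ ^ 2 * t 1 : ℝ) : ℂ) + ((σ * t 2 : ℝ) : ℂ) * I)) : ℝ) : ℂ)) := by
    funext t
    exact treeLine_rescaled_eq hu hσ hσ1 Λ θs t
  rw [hR, fourier_const_mul, norm_mul, Complex.norm_real, Real.norm_eq_abs, abs_of_nonneg (by positivity)]
  -- the dual point and its coordinates
  set y : MomSpace := WithLp.toLp 2 ![σ ^ 2 * dualPoint x.1 x.2 0,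
      σ ^ 2 * (Real.cos θs * dualPoint x.1 x.2 1 + Real.sin θs * dualPoint x.1 x.2 2),
      σ * (-Real.sin θs * dualPoint x.1 x.2 1 + Real.cos θs * dualPoint x.1 x.2 2)] with hy
  have hy0 : 2 * Real.pi * |y 0| = |x.1 * σ ^ 2| := by
    simp only [hy, dualPoint, PiLp.toLp_apply, Matrix.cons_val_zero]
    rw [abs_mul, abs_mul, abs_div, abs_of_pos (by positivity : (0 : ℝ) < 2 * Real.pi), abs_of_pos (by positivity : (0 : ℝ) < σ ^ 2)]
    field_simp
  have hy1 : 2 * Real.pi * |y 1| = |(x.2 0 * Real.cos θs + x.2 1 * Real.sin θs) * σ ^ 2| := by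
    simp only [hy, dualPoint, PiLp.toLp_apply, Matrix.cons_val_zero, Matrix.cons_val_one, Matrix.cons_val_two,
      Matrix.tail_cons, Matrix.head_cons]
    rw [show σ ^ 2 * (Real.cos θs * (-x.2 0 / (2 * Real.pi)) + Real.sin θs * (-x.2 1 / (2 * Real.pi))) =
      -((x.2 0 * Real.cos θs + x.2 1 * Real.sin θs) * σ ^ 2) / (2 * Real.pi) by ring, abs_div, abs_neg,
      abs_of_pos (by positivity : (0 : ℝ) < 2 * Real.pi)]
    field_simp
  have hy2 : 2 * Real.pi * |y 2| = |(-x.2 0 * Real.sin θs + x.2 1 * Real.cos θs) * σ| := by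
    simp only [hy, dualPoint, PiLp.toLp_apply, Matrix.cons_val_zero, Matrix.cons_val_one, Matrix.cons_val_two,
      Matrix.tail_cons, Matrix.head_cons]
    rw [show σ * (-Real.sin θs * (-x.2 0 / (2 * Real.pi)) + Real.cos θs * (-x.2 1 / (2 * Real.pi))) =
      -((-x.2 0 * Real.sin θs + x.2 1 * Real.cos θs) * σ) / (2 * Real.pi) by ring, abs_div, abs_neg,
      abs_of_pos (by positivity : (0 : ℝ) < 2 * Real.pi)]
    field_simp
  have hdecy := hdec σ hσ hσ1 y
  rw [hy0, hy1, hy2] at hdecy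
  -- assembling the prefactor `(2π)^{-3} σ⁵ (1 − Λ²)σ^{-6} = K/(2π)^3-free part · (1 − Λ²)/σ⁸ · σ · σ⁶`
  have hfin : 1 / (2 * Real.pi) ^ 3 * (σ ^ 2 * σ ^ 2 * σ) * ((1 - Λ ^ 2) / σ ^ 6 *
      ‖𝓕 (fun t : MomSpace => ((deriv u (t 0 ^ 2 + (2 * t 1 + σ ^ 2 * t 1 ^ 2 + t 2 ^ 2) ^ 2) : ℝ) : ℂ) *
          (I * ((t 0 : ℝ) : ℂ) + ((2 * t 1 + σ ^ 2 * t 1 ^ 2 + t 2 ^ 2 : ℝ) : ℂ)) *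
          ((u (σ⁻¹ * arg (((1 + σ ^ 2 * t 1 : ℝ) : ℂ) + ((σ * t 2 : ℝ) : ℂ) * I)) : ℝ) : ℂ)) y‖) =
      K₁ / (2 * Real.pi) ^ 3 * ((1 - Λ ^ 2) / (σ ^ 2) ^ 4) * (σ * (σ ^ 2) ^ 3) *
        (‖𝓕 (fun t : MomSpace => ((deriv u (t 0 ^ 2 + (2 * t 1 + σ ^ 2 * t 1 ^ 2 + t 2 ^ 2) ^ 2) : ℝ) : ℂ) *
          (I * ((t 0 : ℝ) : ℂ) + ((2 * t 1 + σ ^ 2 * t 1 ^ 2 + t 2 ^ 2 : ℝ) : ℂ)) *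
          ((u (σ⁻¹ * arg (((1 + σ ^ 2 * t 1 : ℝ) : ℂ) + ((σ * t 2 : ℝ) : ℂ) * I)) : ℝ) : ℂ)) y‖ / K₁) := by
    field_simp
  rw [hfin]
  refine mul_le_mul_of_nonneg_left ?_ (mul_nonneg (mul_nonneg (by positivity) (div_nonneg h1Λ (by positivity))) (by positivity))
  rw [div_le_iff₀ hK₁, mul_comm]
  exact hdecy


end Literature.MathematicalPhysics.QuantumLattice.FermiRG.DR2000

end
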